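import Literature.Geometry.Lorentzian.CommonDevelopmentEmbedding
import Literature.Geometry.Lorentzian.GluedTimeOrientation
import Literature.Geometry.Lorentzian.RelativeDevelopmentGluingCauchy
import Literature.Geometry.Lorentzian.DataEmbeddingNormalSmooth
import Literature.Geometry.Lorentzian.CauchyHypersurfaceCausalProofs
import Literature.Geometry.Lorentzian.CauchyHypersurfaceGlobalHyperbolicity
import Literature.Geometry.Lorentzian.CausalityPushUp
import Literature.Geometry.Lorentzian.CausalityChronologyProofs
import Literature.Topology.FourManifolds.GluingConstruction
import HarnessLib

/-!
# Gluing the development of a HYPERSURFACE datum into a development: glued space, metric,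
# Cauchy property of the larger data hypersurface, and the glued vacuum development
# (Hawking–Ellis 1973, §7.6; Sbierski 2016, §3.3 — hypersurface form)

The gluing constructions of the tree compare two Cauchy developments of the SAME data
(`DevelopmentGluing*`, Sbierski 2016, §3.3) or a development of a SUB-datum `ι_X(Φ N) ⊆ ι_X(X)` with
a development of the datum (`RelativeDevelopmentGluing*`, over a map `Φ : N → X` of data
manifolds, `ψ ∘ ι₁ = ι_X ∘ Φ`; Hawking–Ellis 1973, §7.5–7.6, "a portion of `𝓢`"). The maximal
development of the data induced on an arbitrary acausal spacelike HYPERSURFACE `S = ι₂(N)` of a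
Cauchy development `𝒟₂ = (M₂, g₂, ι_X)` — e.g. a hyperboloidal leaf, which is no portion of any
Cauchy hypersurface of `M₂` — is compared with `𝒟₂` by the same construction along a common
development `(U ⊆ M₁, ψ : U → M₂)` of a Cauchy development `𝒟₁ = (M₁, g₁, ι₁)` of data on `N`
lying over an ARBITRARY map `ι₂ : N → M₂`: `ψ ∘ ι₁ = ι₂` (Hawking–Ellis 1973, §7.6, pp. 250–251:
developments of a spacelike surface `𝓗` inside developments of `𝓢`; Choquet-Bruhat–Geroch 1969,
p. 334, domain of dependence). This file carries the construction out:

* `CauchyDevelopment.HypCommonDevelopment 𝒟₁ 𝒟₂ ι₂` — the datum `(U, ψ)`; the glued space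
  `Glued = (M₁ ⊔ M₂)/∼` over the pushout of smooth manifolds
  (`Literature.Topology.FourManifolds.SmoothGlueData`), `inl`, `inr`, `inl_eq_inr_iff`,
  `inl_embed_eq_inr_embed : π j₁ ι₁ = π j₂ ι₂`; corresponding boundary points (Sbierski 2016,
  Def. 11), `isClosed_graph_iff_not_hasCorrespondingBoundaryPoints`, `t2Space_glued`; second
  countability and connectedness — transcribed word for word from `RelativeDevelopmentGluingData`
  (the case `ι₂ = ι_X ∘ Φ`), whose proofs never use the form of `ι₂`;
* `gluedMetric`, `gluedTimeOrientation`, `gluedSpacetime`, `isIsometricImmersion_inl/inr`,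
  `preservesTimeOrientation_inl/inr` — transcribed from `RelativeDevelopmentGluingMetric`;
* **`isCauchyHypersurface_glued` — NEW: the data hypersurface `Σ̃ = π j₂(ι_X(X))` of the LARGER
  datum is a Cauchy hypersurface of the glued spacetime**, under the two hypotheses that distinguish
  the hypersurface case: (hD) `ψ(U) ⊆ D̃(ι₂ N)` — every endless timelike curve of `M₂` through a
  point of `ψ(U)` meets `ι₂(N)` (in the application `ψ(U)` is the domain of dependence of `ι₂(N)`,
  O'Neill 1983, Def. 14.35) — and (hac) `ι₂(N)` is achronal in `M₂`. In the relative case `Σ̃` meets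
  the piece `π j₁(M₁)` exactly along `π j₁(ι₁ N)`, so lifts to `M₁` count the crossings
  (`RelativeDevelopmentGluingCauchy`); here `Σ̃ ∩ π j₁(M₁)` is unrelated to `ι₁(N)` and the
  argument is different (see below);
* `gluedDataEmbedding`, `gluedCauchyDevelopment`, `isRicciFlat_gluedMetric`,
  `hypGluedVacuumCauchyDevelopment`, and the packaged statements
  `VacuumCauchyDevelopment.exists_hypersurface_extension_of_not_hasCorrespondingBoundaryPoints`
  (over the datum) and `VacuumCauchyDevelopment.exists_hypersurface_extension_of_not_clusterPt`
  (over the seven displayed conjuncts of a realised common sub-development, injectivity of `ψ` on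
  `U`, (hD), (hac) and the absence of cluster points of `ψ` along `U` at `∂U`) — transcribed from
  `RelativeDevelopmentGluing` with the Cauchy field supplied by the new theorem.

**Proof of `isCauchyHypersurface_glued`.** Existence of a crossing (`exists_crossing`): a piece of
an endless timelike curve `γ` of `M̃` inside `π j₂(M₂)` lifts to an endless timelike curve of `M₂`
and meets `Σ̃` exactly once (`crossing_inr`, `TimelikeCurveLift`); a piece inside `π j₁(M₁)` lifts
to `M₁`, meets `ι₁(N)`, and `π j₁(ι₁ N) = π j₂(ι₂ N) ⊆ π j₂(M₂)`. Uniqueness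
(`not_two_crossings`): two crossings `t₁ < t₃` lie on different pieces inside `π j₂(M₂)`, so
`γ t' ∉ π j₂(M₂)` for some `t' ∈ (t₁, t₃)`; the piece `K ∋ t'` inside `π j₁(M₁)` lifts to an
endless timelike `δ` of `M₁` crossing `ι₁(N)` once, at `t_K ≠ t'`, say `t_K < t'`. A real-variable
exit lemma (`exists_mem_connectedComponentIn_Ioc`) gives `t⋆ ∈ K ∩ (t', t₃]` with
`γ t⋆ ∈ π j₂(M₂)`; the piece `J ∋ t⋆` inside `π j₂(M₂)` lies beyond `t'` and lifts to an endless
timelike `ε` of `M₂` with `ε = ψ ∘ δ` on `J ∩ K`. As `δ t⋆ ∈ I⁺(ι₁ N) ∩ U ∖ ι₁(N)`, the dichotomy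
`U ∖ ι₁(N) = I⁺_U ⊔ I⁻_U` of the Cauchy hypersurface `ι₁(N)` of `U` and `I⁺ ∩ I⁻ = ∅` in `M₁` put
`δ t⋆ ∈ I⁺_U(ι₁ N)`, whence `ε t⋆ = ψ(δ t⋆) ∈ I⁺(ι₂ N)` in `M₂` (`map_mem_chronologicalFuture_of_mem`).
By (hD), `ε` meets `ι₂(N)` at some `t_s ∈ J`: `t_s < t⋆` forces `t_s ∈ (t', t⋆) ⊆ K`, a crossing
of `ι₁(N)` by `δ` other than `t_K`; `t_s ≥ t⋆` gives two chronologically related points of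
`ι₂(N)`, against (hac). The case `t' < t_K` is the time dual (exit to the left towards `t₁`,
`exists_mem_connectedComponentIn_Ico`, `exists_mem_chronologicalFuture_map_of_mem`).

No named facts are introduced (D-0026): `HypCommonDevelopment`, `glue`, `glueData`, the two
predicates of Def. 11, `gluedPseudoMetric`, `gluedMetric`, `inlVec`, `inrVec`,
`gluedTimeOrientation`, `gluedSpacetime`, `gluedDataEmbedding`, `gluedCauchyDevelopment`, `inrZ`,
`inlZ`, `hypGluedVacuumCauchyDevelopment` are definitions with bodies; everything else is proved.
The file is the concatenation of the four parts (data / metric / Cauchy / development), each in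
its own namespace block, mirroring the four `RelativeDevelopmentGluing*` files. Consumer: the
hypersurface sub-data maximality statement of summit `FinalStateConjecture`
(`stub_hypersurfaceMGHDRealised`, crux `CaptureSufficesC2`), which glues the maximal development
of the leaf datum to a maximal development along the domain of dependence of the leaf.

## References

* S. W. Hawking, G. F. R. Ellis, *The large scale structure of space-time*, CUP 1973, §7.6,
  pp. 249–251. [HawkingEllis1973CUP]
* Y. Choquet-Bruhat, R. Geroch, Comm. Math. Phys. 14 (1969) 329–335, proof of Thm. 3, p. 334.
  [ChoquetBruhatGeroch1969CMP]
* J. Sbierski, Ann. Henri Poincaré 17 (2016) 301–329 = arXiv:1309.7591v3, §2 Def. 2.4, §3.2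
  Def. 11, §3.3 proof of Thm. 5. [Sbierski2016AHP]
* B. O'Neill, *Semi-Riemannian geometry with applications to relativity*, Academic Press 1983,
  Ch. 14, Def. 14.28, Lemma 14.29, Def. 14.35. [ONeillSemiRiemannian1983]
* A. Kosinski, *Differential Manifolds* (1993), VI.1 (gluing along a partial diffeomorphism).
-/

noncomputable section

open Bundle Set Function Filter TopologicalSpace Topology Manifold VectorField
open scoped Manifold ContDiff Topology
open Literature.Topology.FourManifolds

namespace Literature.Geometry.Lorentzian

universe u

section Developments

variable {n : ℕ} {N : Type u} [TopologicalSpace N] [ChartedSpace (EuclideanSpace ℝ (Fin n)) N]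
  [IsManifold (𝓡 n) ∞ N] [ConnectedSpace N] {D₁ : InitialDataSet (𝓡 n) N}
  {X : Type u} [TopologicalSpace X] [ChartedSpace (EuclideanSpace ℝ (Fin n)) X]
  [IsManifold (𝓡 n) ∞ X] [ConnectedSpace X] {D₂ : InitialDataSet (𝓡 n) X}

namespace CauchyDevelopment

/-- **A common globally hyperbolic development of `𝒟₁` and the spacetime of `𝒟₂` over a map
`ι₂ : N → M₂`** (the datum `(U, ψ)` of Sbierski 2016, Def. 2.4 and §3.3, for a development of
data on `N` and a development of OTHER data whose spacetime merely receives `N` through `ι₂`): an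
open subset `U` of the spacetime of the Cauchy development `𝒟₁ = (M₁, g₁, τ₁, ι₁, ν₁)` of data
`D₁` on `N` containing the data hypersurface `ι₁(N)`, in which `ι₁(N)` is a Cauchy hypersurface
(for `g₁|_U`, `τ₁|_U`), and an injective time-orientation preserving isometric immersion
`ψ : (U, g₁|_U, τ₁|_U) → (M₂, g₂, τ₂)` into the spacetime of the Cauchy development `𝒟₂` of data
`D₂` on `X`, lying OVER `ι₂`: `ψ ∘ ι₁ = ι₂` (Hawking–Ellis 1973, §7.6: a development of a
spacelike surface `𝓗` inside a development of `𝓢`). For `ι₂ = 𝒟₂.embed ∘ Φ` this is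
`RelCommonDevelopment 𝒟₁ 𝒟₂ Φ` (`RelativeDevelopmentGluingData`).
[cite: Sbierski2016AHP, §2, Def. 2.4 (arXiv: Def. 4) and §3.3] -/
structure HypCommonDevelopment (𝒟₁ : CauchyDevelopment D₁) (𝒟₂ : CauchyDevelopment D₂)
    (ι₂ : N → 𝒟₂.carrier) where
  /-- The open subset `U ⊆ M₁`. -/
  opens : Opens 𝒟₁.carrier
  /-- `ι₁(N) ⊆ U`. -/
  embed_mem : ∀ x, 𝒟₁.embed x ∈ opens
  /-- `ι₁(N)` is a Cauchy hypersurface of `(U, g₁|_U, τ₁|_U)`. -/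
  isCauchyHypersurface :
    (𝒟₁.metric.restrict PseudoRiemannianMetric.contMDiff_restrict_holds opens).IsCauchyHypersurface
      (𝒟₁.timeOrientation.restrict PseudoRiemannianMetric.contMDiff_restrict_holds
        𝒟₁.timeOrientation.contMDiff_restrict_holds opens) (Subtype.val ⁻¹' range 𝒟₁.embed)
  /-- The map `ψ : U → M₂`. -/
  map : opens → 𝒟₂.carrier
  /-- `ψ` is an isometric immersion of `(U, g₁|_U)` into `(M₂, g₂)`. -/
  isIsometricImmersion :
    (𝒟₁.metric.restrict PseudoRiemannianMetric.contMDiff_restrict_holds opens).IsIsometricImmersion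
      𝒟₂.metric.toPseudoRiemannianMetric map
  /-- `ψ` preserves the time orientations. -/
  preservesTimeOrientation :
    (𝒟₁.timeOrientation.restrict PseudoRiemannianMetric.contMDiff_restrict_holds
      𝒟₁.timeOrientation.contMDiff_restrict_holds opens).PreservesTimeOrientation map
        𝒟₂.timeOrientation
  /-- `ψ` lies over `ι₂`: `ψ ∘ ι₁ = ι₂`. -/
  map_comp_embedOpens : map ∘ 𝒟₁.embedOpens opens embed_mem = ι₂
  /-- `ψ` is injective. -/
  injective_map : Injective map

namespace HypCommonDevelopment

variable {𝒟₁ : CauchyDevelopment D₁} {𝒟₂ : CauchyDevelopment D₂} {ι₂ : N → 𝒟₂.carrier}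
  (𝔠 : HypCommonDevelopment 𝒟₁ 𝒟₂ ι₂)

/-- `ψ (ι₁ x) = ι₂ x`. [cite: Sbierski2016AHP, §2, Def. 2.3–2.4 (arXiv: Def. 3–4)] -/
theorem map_embedOpens (x : N) :
    𝔠.map (𝒟₁.embedOpens 𝔠.opens 𝔠.embed_mem x) = ι₂ x :=
  congrFun 𝔠.map_comp_embedOpens x

/-- The open subset of a common development is nonempty (it contains `ι(X)`, `X ≠ ∅`). [folklore] -/
instance nonempty_opens : Nonempty 𝔠.opens := by
  obtain ⟨x⟩ : Nonempty N := inferInstance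
  exact ⟨𝒟₁.embedOpens 𝔠.opens 𝔠.embed_mem x⟩

/-- `ψ` is smooth. [cite: Sbierski2016AHP, §2, Def. 2.3 (arXiv: Def. 3)] -/
theorem contMDiff_map : ContMDiff (𝓡 (n + 1)) (𝓡 (n + 1)) ∞ 𝔠.map :=
  𝔠.isIsometricImmersion.1

/-- `ψ` is a local diffeomorphism (an isometric immersion between manifolds of the same
dimension). [cite: Sbierski2016AHP, §3.1, Lemma 9 (arXiv numbering)] -/
theorem isLocalDiffeomorph_map : IsLocalDiffeomorph (𝓡 (n + 1)) (𝓡 (n + 1)) ∞ 𝔠.map :=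
  LorentzianMetric.isLocalDiffeomorph_of_isIsometricImmersion 𝔠.isIsometricImmersion

/-- **`ψ` is an open embedding**: an injective local diffeomorphism.
[cite: Sbierski2016AHP, §3.1, Lemma 9 (arXiv numbering)] -/
theorem isOpenEmbedding_map : IsOpenEmbedding 𝔠.map :=
  𝔠.isLocalDiffeomorph_map.isLocalHomeomorph.isOpenEmbedding_of_injective 𝔠.injective_map

/-! ### The gluing map as an open partial homeomorphism `M ⇀ M'` -/

/-- **The gluing map** `ψ` as an open partial homeomorphism `M ⇀ M'` with source `U` and target
`ψ(U)`: the inverse of the inclusion `U ↪ M` followed by the open embedding `ψ`.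
[cite: Sbierski2016AHP, §3.3, proof of Thm. 5 (the identification `p ∼ ψ(p)`)] -/
def glue : OpenPartialHomeomorph 𝒟₁.carrier 𝒟₂.carrier :=
  (𝔠.opens.openPartialHomeomorphSubtypeCoe 𝔠.nonempty_opens).symm.trans
    (𝔠.isOpenEmbedding_map.toOpenPartialHomeomorph 𝔠.map)

/-- The source of the gluing map is `U`. [folklore] -/
@[simp]
theorem glue_source : 𝔠.glue.source = (𝔠.opens : Set 𝒟₁.carrier) := by
  simp [glue]

/-- The target of the gluing map is `ψ(U)`. [folklore] -/
@[simp]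
theorem glue_target : 𝔠.glue.target = range 𝔠.map := by
  simp [glue]

/-- The inverse of the inclusion `U ↪ M` at a point of `U`. [folklore] -/
theorem subtypeCoe_symm_apply {p : 𝒟₁.carrier} (hp : p ∈ 𝔠.opens) :
    (𝔠.opens.openPartialHomeomorphSubtypeCoe 𝔠.nonempty_opens).symm p = ⟨p, hp⟩ := by
  have h := (𝔠.opens.openPartialHomeomorphSubtypeCoe 𝔠.nonempty_opens).left_inv
    (x := ⟨p, hp⟩) (by simp)
  simpa using h

/-- **On `U` the gluing map is `ψ`**: `glue p = ψ ⟨p, _⟩`. [folklore] -/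
theorem glue_apply {p : 𝒟₁.carrier} (hp : p ∈ 𝔠.opens) : 𝔠.glue p = 𝔠.map ⟨p, hp⟩ := by
  simp [glue, 𝔠.subtypeCoe_symm_apply hp]

/-- `glue ∘ Subtype.val = ψ` on `U`. [folklore] -/
theorem glue_comp_subtypeVal : 𝔠.glue ∘ (Subtype.val : 𝔠.opens → 𝒟₁.carrier) = 𝔠.map :=
  funext fun y ↦ 𝔠.glue_apply y.2

/-- The inverse gluing map on `ψ(U)`: `glue.symm (ψ y) = y`. [folklore] -/
theorem glue_symm_apply_map (y : 𝔠.opens) : 𝔠.glue.symm (𝔠.map y) = y := by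
  have h : 𝔠.glue y = 𝔠.map y := 𝔠.glue_apply y.2
  rw [← h]
  exact 𝔠.glue.left_inv (by simp)

/-- **The gluing map is smooth on `U`.** [cite: Sbierski2016AHP, §3.3, proof of Thm. 5 ("smooth diffeomorphisms")] -/
theorem contMDiffOn_glue : ContMDiffOn (𝓡 (n + 1)) (𝓡 (n + 1)) ∞ 𝔠.glue 𝔠.glue.source := by
  rw [glue_source]
  intro p hp
  have h : ContMDiffAt (𝓡 (n + 1)) (𝓡 (n + 1)) ∞ (fun y : 𝔠.opens ↦ 𝔠.glue y) ⟨p, hp⟩ := by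
    have heq : (fun y : 𝔠.opens ↦ 𝔠.glue y) = 𝔠.map := 𝔠.glue_comp_subtypeVal
    rw [heq]
    exact 𝔠.contMDiff_map ⟨p, hp⟩
  exact (contMDiffAt_subtype_iff.mp h).contMDiffWithinAt

/-- The gluing map is differentiable at the points of `U`, with the differential of `ψ`.
[folklore] -/
theorem mfderiv_glue_eq (y : 𝔠.opens) :
    mfderiv (𝓡 (n + 1)) (𝓡 (n + 1)) 𝔠.glue y.1 = mfderiv (𝓡 (n + 1)) (𝓡 (n + 1)) 𝔠.map y := by
  have hd : MDifferentiableAt (𝓡 (n + 1)) (𝓡 (n + 1)) 𝔠.glue y.1 :=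
    (𝔠.contMDiffOn_glue.contMDiffAt (by
      rw [glue_source]; exact 𝔠.opens.2.mem_nhds y.2)).mdifferentiableAt (by simp)
  rw [← mfderiv_comp_subtypeVal (I' := 𝓡 (n + 1)) (I := 𝓡 (n + 1)) (W := 𝔠.opens) hd,
    glue_comp_subtypeVal]

/-- **The inverse gluing map is smooth on `ψ(U)`**: near `ψ y` it is the inclusion composed with
a local inverse of the local diffeomorphism `ψ`. [cite: Sbierski2016AHP, §3.3, proof of Thm. 5 ("smooth diffeomorphisms")] -/
theorem contMDiffOn_glue_symm :
    ContMDiffOn (𝓡 (n + 1)) (𝓡 (n + 1)) ∞ 𝔠.glue.symm 𝔠.glue.target := by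
  rw [glue_target]
  rintro _ ⟨y, rfl⟩
  obtain ⟨Φ, hyΦ, heq⟩ := 𝔠.isLocalDiffeomorph_map y
  -- near `ψ y`, `glue.symm = Subtype.val ∘ Φ.symm`
  have htgt : IsOpen Φ.target := Φ.open_target
  have hyt : 𝔠.map y ∈ Φ.target := by rw [heq hyΦ]; exact Φ.map_source hyΦ
  have hev : 𝔠.glue.symm =ᶠ[𝓝 (𝔠.map y)] (Subtype.val ∘ Φ.symm) := by
    filter_upwards [htgt.mem_nhds hyt] with z hz
    have hw : Φ.symm z ∈ Φ.source := Φ.map_target hz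
    have hz' : z = 𝔠.map (Φ.symm z) := by rw [heq hw]; exact (Φ.right_inv hz).symm
    rw [comp_apply, hz', 𝔠.glue_symm_apply_map]
    exact congrArg Subtype.val (by rw [← hz'])
  have hsm : ContMDiffAt (𝓡 (n + 1)) (𝓡 (n + 1)) ∞ (Subtype.val ∘ Φ.symm) (𝔠.map y) :=
    (contMDiff_subtype_val.contMDiffAt).comp _
      ((Φ.contMDiffOn_invFun.contMDiffAt (htgt.mem_nhds hyt)))
  exact (hsm.congr_of_eventuallyEq hev).contMDiffWithinAt

/-- **The gluing datum** of a common development: `M` and `M'` glued along the partial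
diffeomorphism `ψ : U ≅ ψ(U)` (`Literature.Topology.FourManifolds.SmoothGlueData`, model
`ℝ^{n+1}` on both sides). [cite: Sbierski2016AHP, §3.3, proof of Thm. 5] -/
def glueData : SmoothGlueData (𝓡 (n + 1)) (𝓡 (n + 1)) 𝒟₁.carrier 𝒟₂.carrier
    (EuclideanSpace ℝ (Fin (n + 1))) where
  glue := 𝔠.glue
  contMDiffOn_glue := 𝔠.contMDiffOn_glue
  contMDiffOn_glue_symm := 𝔠.contMDiffOn_glue_symm
  linA := ContinuousLinearEquiv.refl ℝ _
  linB := ContinuousLinearEquiv.refl ℝ _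

/-- The gluing map of the gluing datum is `glue`. [folklore] -/
@[simp]
theorem glueData_glue : 𝔠.glueData.glue = 𝔠.glue := rfl

/-- **The glued space** `M̃ = (M ⊔ M')/∼`, `p ∼ ψ(p)` for `p ∈ U`, with the quotient topology and
its smooth structure (`SmoothGlueData.Glued`). [cite: Sbierski2016AHP, §3.3, proof of Thm. 5] -/
abbrev Glued : Type u := 𝔠.glueData.Glued

/-- The first piece `π ∘ j : M → M̃`. [cite: Sbierski2016AHP, §3.3, proof of Thm. 5] -/
abbrev inl : 𝒟₁.carrier → 𝔠.Glued := 𝔠.glueData.inl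

/-- The second piece `π ∘ j' : M' → M̃`. [cite: Sbierski2016AHP, §3.3, proof of Thm. 5] -/
abbrev inr : 𝒟₂.carrier → 𝔠.Glued := 𝔠.glueData.inr

/-- **The identification**: `π j p = π j' p'` iff `p ∈ U` and `p' = ψ p`.
[cite: Sbierski2016AHP, §3.3, proof of Thm. 5] -/
theorem inl_eq_inr_iff {p : 𝒟₁.carrier} {p' : 𝒟₂.carrier} :
    𝔠.inl p = 𝔠.inr p' ↔ ∃ hp : p ∈ 𝔠.opens, 𝔠.map ⟨p, hp⟩ = p' := by
  rw [inl, inr, 𝔠.glueData.inl_eq_inr_iff, glueData_glue]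
  constructor
  · rintro ⟨hp, h⟩
    rw [glue_source] at hp
    exact ⟨hp, by rw [← 𝔠.glue_apply hp]; exact h⟩
  · rintro ⟨hp, h⟩
    refine ⟨by rw [glue_source]; exact hp, ?_⟩
    rw [𝔠.glue_apply hp]
    exact h

/-- `π j' (ψ y) = π j y`. [cite: Sbierski2016AHP, §3.3, proof of Thm. 5] -/
theorem inr_map (y : 𝔠.opens) : 𝔠.inr (𝔠.map y) = 𝔠.inl y :=
  (𝔠.inl_eq_inr_iff.2 ⟨y.2, rfl⟩).symm

/-- **The data embedding of `𝒟₁` and the map `ι₂` agree in the glued space**: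
`π j₁ (ι₁ x) = π j₂ (ι₂ x)` (`ι₁(N) ⊆ U` and `ψ ∘ ι₁ = ι₂`). [cite: Sbierski2016AHP, §3.3, proof of Thm. 5 (`ι̃ := π ∘ j ∘ ι`)] -/
theorem inl_embed_eq_inr_embed (x : N) : 𝔠.inl (𝒟₁.embed x) = 𝔠.inr (ι₂ x) :=
  𝔠.inl_eq_inr_iff.2 ⟨𝔠.embed_mem x, 𝔠.map_embedOpens x⟩

/-! ### Corresponding boundary points (Sbierski 2016, Def. 11) and the Hausdorff property -/

/-- **Corresponding boundary points** (Sbierski 2016, Def. 11): `p ∈ ∂U ⊆ M` and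
`p' ∈ ∂ψ(U) ⊆ M'` *correspond* if for all neighbourhoods `V` of `p` and `V'` of `p'` one has
`ψ⁻¹(V' ∩ ψ(U)) ∩ V ≠ ∅`, i.e. some point of `U` in `V` is mapped into `V'`.
[cite: Sbierski2016AHP, §3.2, Def. 11 (arXiv numbering)] -/
def IsCorrespondingPair (p : 𝒟₁.carrier) (p' : 𝒟₂.carrier) : Prop :=
  p ∈ frontier (𝔠.opens : Set 𝒟₁.carrier) ∧ p' ∈ frontier (range 𝔠.map) ∧
    ∀ V ∈ 𝓝 p, ∀ V' ∈ 𝓝 p', ∃ y : 𝔠.opens, (y : 𝒟₁.carrier) ∈ V ∧ 𝔠.map y ∈ V'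

/-- `U` **has corresponding boundary points** (in `M` and `M'`): some pair of boundary points
corresponds (the set `C` of Sbierski 2016, §3.2, is nonempty). [cite: Sbierski2016AHP, §3.2, Def. 11 and Thm. 12 (arXiv numbering)] -/
def HasCorrespondingBoundaryPoints (𝔠 : HypCommonDevelopment 𝒟₁ 𝒟₂ ι₂) : Prop :=
  ∃ p p', 𝔠.IsCorrespondingPair p p'

/-- The graph of the gluing map `{(p, ψ p) | p ∈ U} ⊆ M × M'`. [folklore] -/
theorem mem_graph_iff {q : 𝒟₁.carrier × 𝒟₂.carrier} :
    q ∈ {q : 𝒟₁.carrier × 𝒟₂.carrier | q.1 ∈ 𝔠.glue.source ∧ 𝔠.glue q.1 = q.2} ↔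
      ∃ hp : q.1 ∈ 𝔠.opens, 𝔠.map ⟨q.1, hp⟩ = q.2 := by
  simp only [mem_setOf_eq, glue_source, SetLike.mem_coe]
  constructor
  · rintro ⟨hp, h⟩
    exact ⟨hp, by rw [← 𝔠.glue_apply hp]; exact h⟩
  · rintro ⟨hp, h⟩
    exact ⟨hp, by rw [𝔠.glue_apply hp]; exact h⟩

/-- A pair in the closure of the graph of `ψ` satisfies the neighbourhood condition of Def. 11.
[folklore] -/
theorem forall_nhds_of_mem_closure_graph {p : 𝒟₁.carrier} {p' : 𝒟₂.carrier}
    (h : (p, p') ∈ closure {q : 𝒟₁.carrier × 𝒟₂.carrier | q.1 ∈ 𝔠.glue.source ∧ 𝔠.glue q.1 = q.2}) :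
    ∀ V ∈ 𝓝 p, ∀ V' ∈ 𝓝 p', ∃ y : 𝔠.opens, (y : 𝒟₁.carrier) ∈ V ∧ 𝔠.map y ∈ V' := by
  intro V hV V' hV'
  rw [mem_closure_iff_nhds] at h
  obtain ⟨⟨a, b⟩, hab, hgr⟩ := h (V ×ˢ V') (prod_mem_nhds hV hV')
  obtain ⟨ha, hmap⟩ := 𝔠.mem_graph_iff.1 hgr
  exact ⟨⟨a, ha⟩, hab.1, by rw [hmap]; exact hab.2⟩

/-- Conversely, the neighbourhood condition of Def. 11 puts the pair in the closure of the graph.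
[folklore] -/
theorem mem_closure_graph_of_forall_nhds {p : 𝒟₁.carrier} {p' : 𝒟₂.carrier}
    (h : ∀ V ∈ 𝓝 p, ∀ V' ∈ 𝓝 p', ∃ y : 𝔠.opens, (y : 𝒟₁.carrier) ∈ V ∧ 𝔠.map y ∈ V') :
    (p, p') ∈ closure {q : 𝒟₁.carrier × 𝒟₂.carrier | q.1 ∈ 𝔠.glue.source ∧ 𝔠.glue q.1 = q.2} := by
  rw [mem_closure_iff_nhds]
  intro W hW
  obtain ⟨V, hV, V', hV', hsub⟩ := mem_nhds_prod_iff.1 hW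
  obtain ⟨y, hyV, hyV'⟩ := h V hV V' hV'
  exact ⟨(y.1, 𝔠.map y), hsub (mk_mem_prod hyV hyV'), 𝔠.mem_graph_iff.2 ⟨y.2, rfl⟩⟩

/-- **The closure of the graph of `ψ` consists of the graph and the corresponding pairs**: a
pair in the closure but not in the graph is a pair of corresponding boundary points. Indeed if
`p ∈ U` then `p' = ψ p` by continuity of `ψ` at `p` (so the pair is in the graph), hence
`p ∈ Ū ∖ U = ∂U`; symmetrically `p' ∈ ∂ψ(U)` by continuity of `ψ⁻¹` on the open set `ψ(U)`.
[cite: Sbierski2016AHP, §3.2, Def. 11 and §3.3, proof of Thm. 5 (Hausdorff step)] -/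
theorem isCorrespondingPair_of_mem_closure_graph {p : 𝒟₁.carrier} {p' : 𝒟₂.carrier}
    (h : (p, p') ∈ closure {q : 𝒟₁.carrier × 𝒟₂.carrier | q.1 ∈ 𝔠.glue.source ∧ 𝔠.glue q.1 = q.2})
    (hn : (p, p') ∉ {q : 𝒟₁.carrier × 𝒟₂.carrier | q.1 ∈ 𝔠.glue.source ∧ 𝔠.glue q.1 = q.2}) :
    𝔠.IsCorrespondingPair p p' := by
  have hN := 𝔠.forall_nhds_of_mem_closure_graph h
  refine ⟨⟨?_, ?_⟩, ⟨?_, ?_⟩, hN⟩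
  · -- `p ∈ closure U`
    rw [mem_closure_iff_nhds]
    intro V hV
    obtain ⟨y, hyV, -⟩ := hN V hV univ univ_mem
    exact ⟨y.1, hyV, y.2⟩
  · -- `p ∉ interior U = U`: otherwise `p' = ψ p` by continuity of `ψ` at `p`
    rw [𝔠.opens.isOpen.interior_eq]
    intro hp
    apply hn
    refine (𝔠.mem_graph_iff (q := (p, p'))).2 ⟨hp, ?_⟩
    by_contra hne
    obtain ⟨W, W', hWo, hW'o, hW, hW', hdisj⟩ := t2_separation hne
    have hc : ContinuousAt 𝔠.glue p := 𝔠.glue.continuousAt (by rw [glue_source]; exact hp)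
    have hV : 𝔠.glue ⁻¹' W ∈ 𝓝 p :=
      hc.preimage_mem_nhds (hWo.mem_nhds (by rw [𝔠.glue_apply hp]; exact hW))
    obtain ⟨y, hyV, hyW'⟩ := hN _ hV W' (hW'o.mem_nhds hW')
    have hyW : 𝔠.map y ∈ W := by
      have h' : 𝔠.glue y ∈ W := hyV
      rwa [𝔠.glue_apply y.2] at h'
    exact Set.disjoint_left.1 hdisj hyW hyW'
  · -- `p' ∈ closure ψ(U)`
    rw [mem_closure_iff_nhds]
    intro V' hV'
    obtain ⟨y, -, hyV'⟩ := hN univ univ_mem V' hV'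
    exact ⟨𝔠.map y, hyV', y, rfl⟩
  · -- `p' ∉ interior ψ(U) = ψ(U)`: otherwise `p = ψ⁻¹ p'` by continuity of `ψ⁻¹` on `ψ(U)`
    rw [𝔠.isOpenEmbedding_map.isOpen_range.interior_eq]
    rintro ⟨y₀, rfl⟩
    apply hn
    suffices hpy : p = y₀.1 by
      subst hpy
      exact (𝔠.mem_graph_iff (q := ((y₀ : 𝒟₁.carrier), 𝔠.map y₀))).2 ⟨y₀.2, rfl⟩
    by_contra hne
    obtain ⟨W, W₀, hWo, hW₀o, hW, hW₀, hdisj⟩ := t2_separation hne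
    have hO : IsOpen (𝔠.map '' (Subtype.val ⁻¹' W₀)) :=
      𝔠.isOpenEmbedding_map.isOpenMap _ (hW₀o.preimage continuous_subtype_val)
    obtain ⟨y, hyW, y', hy'W₀, hyy'⟩ := hN W (hWo.mem_nhds hW) _ (hO.mem_nhds ⟨y₀, hW₀, rfl⟩)
    have hyy : y' = y := 𝔠.injective_map hyy'
    subst hyy
    exact Set.disjoint_left.1 hdisj hyW hy'W₀

/-- **The graph of `ψ` is closed in `M × M'` iff `U` has no corresponding boundary points**
(the content of *"this is exactly the statement that there are no corresponding boundary
points"*, Sbierski 2016, §3.3): a corresponding pair lies in the closure of the graph but not in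
the graph (`p ∈ ∂U` is not in the open `U`); conversely a point of the closure outside the graph
is a corresponding pair (`isCorrespondingPair_of_mem_closure_graph`).
[cite: Sbierski2016AHP, §3.3, proof of Thm. 5 (Hausdorff step) with §3.2, Def. 11] -/
theorem isClosed_graph_iff_not_hasCorrespondingBoundaryPoints :
    IsClosed {q : 𝒟₁.carrier × 𝒟₂.carrier | q.1 ∈ 𝔠.glue.source ∧ 𝔠.glue q.1 = q.2} ↔
      ¬ 𝔠.HasCorrespondingBoundaryPoints := by
  constructor
  · rintro hcl ⟨p, p', hfr, -, hN⟩
    have hmem : (p, p') ∈ {q : 𝒟₁.carrier × 𝒟₂.carrier | q.1 ∈ 𝔠.glue.source ∧ 𝔠.glue q.1 = q.2} :=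
      hcl.closure_subset (𝔠.mem_closure_graph_of_forall_nhds hN)
    obtain ⟨hp, -⟩ := 𝔠.mem_graph_iff.1 hmem
    have hp' : p ∉ interior (𝔠.opens : Set 𝒟₁.carrier) := hfr.2
    rw [𝔠.opens.isOpen.interior_eq] at hp'
    exact hp' hp
  · intro h
    refine isClosed_of_closure_subset fun q hq ↦ ?_
    by_contra hqn
    obtain ⟨p, p'⟩ := q
    exact h ⟨p, p', 𝔠.isCorrespondingPair_of_mem_closure_graph hq hqn⟩

/-- **The glued space is Hausdorff if `U` has no corresponding boundary points** (Sbierski 2016,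
§3.3: *"So suppose we could not separate these two points … `p` and `q` are corresponding
boundary points of `U`"*; here through the closed-graph criterion
`SmoothGlueData.t2Space_of_isClosed_graph`). [cite: Sbierski2016AHP, §3.3, proof of Thm. 5 ("`M̃` is indeed Hausdorff")] -/
theorem t2Space_glued (h : ¬ 𝔠.HasCorrespondingBoundaryPoints) : T2Space 𝔠.Glued :=
  𝔠.glueData.t2Space_of_isClosed_graph
    (𝔠.isClosed_graph_iff_not_hasCorrespondingBoundaryPoints.2 h)

/-- **Conversely, corresponding boundary points obstruct the Hausdorff property**: if the glued
space is Hausdorff, `U` has no corresponding boundary points (a corresponding pair `p`, `p'`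
gives two distinct points `π j p ≠ π j' p'` all of whose neighbourhoods meet). Sbierski 2016,
§3.3 (the Hausdorff property of `M̃` "is exactly the statement that there are no corresponding
boundary points"). [cite: Sbierski2016AHP, §3.3, proof of Thm. 5 (Hausdorff step)] -/
theorem not_hasCorrespondingBoundaryPoints_of_t2Space [T2Space 𝔠.Glued] :
    ¬ 𝔠.HasCorrespondingBoundaryPoints := by
  rintro ⟨p, p', hfr, -, hN⟩
  have hp : p ∉ (𝔠.opens : Set 𝒟₁.carrier) := by
    have hp' : p ∉ interior (𝔠.opens : Set 𝒟₁.carrier) := hfr.2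
    rwa [𝔠.opens.isOpen.interior_eq] at hp'
  have hne : 𝔠.inl p ≠ 𝔠.inr p' := fun h ↦ by
    obtain ⟨hpU, -⟩ := 𝔠.inl_eq_inr_iff.1 h
    exact hp hpU
  obtain ⟨A, B, hAo, hBo, hA, hB, hdisj⟩ := t2_separation hne
  obtain ⟨y, hyA, hyB⟩ := hN _ (𝔠.glueData.continuous_inl.continuousAt.preimage_mem_nhds
    (hAo.mem_nhds hA)) _ (𝔠.glueData.continuous_inr.continuousAt.preimage_mem_nhds (hBo.mem_nhds hB))
  have h1 : 𝔠.inl y ∈ A := hyA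
  have h2 : 𝔠.inl y ∈ B := by rw [← 𝔠.inr_map y]; exact hyB
  exact Set.disjoint_left.1 hdisj h1 h2

/-! ### Second countability and connectedness of the glued space -/

/-- The quotient map `M ⊔ M' → M̃` is open (saturations of open sets are open, `inl`, `inr` being
open maps). [folklore] -/
theorem isOpenMap_proj : IsOpenMap 𝔠.glueData.proj := by
  intro s hs
  have heq : 𝔠.glueData.proj '' s =
      𝔠.inl '' (Sum.inl ⁻¹' s) ∪ 𝔠.inr '' (Sum.inr ⁻¹' s) := by
    ext q
    constructor
    · rintro ⟨x | x, hx, rfl⟩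
      · exact Or.inl ⟨x, hx, rfl⟩
      · exact Or.inr ⟨x, hx, rfl⟩
    · rintro (⟨a, ha, rfl⟩ | ⟨b, hb, rfl⟩)
      · exact ⟨Sum.inl a, ha, rfl⟩
      · exact ⟨Sum.inr b, hb, rfl⟩
  rw [heq]
  obtain ⟨h₁, h₂⟩ := isOpen_sum_iff.1 hs
  exact (𝔠.glueData.isOpenMap_inl _ h₁).union (𝔠.glueData.isOpenMap_inr _ h₂)

/-- **The glued space is second countable** (an open quotient of the second countable
`M ⊔ M'`; Sbierski 2016, §3.3: "`M̃` is second countable: This follows directly from the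
previous construction"). [cite: Sbierski2016AHP, §3.3, proof of Thm. 5 ("`M̃` is second countable")] -/
instance secondCountableTopology_glued : SecondCountableTopology 𝔠.Glued :=
  𝔠.glueData.isQuotientMap_proj.secondCountableTopology 𝔠.isOpenMap_proj

/-- **The glued space is connected**: it is the union of the connected images of `M` and `M'`,
which meet (at the image of the data hypersurface). [cite: Sbierski2016AHP, §3.3, proof of Thm. 5] -/
instance connectedSpace_glued : ConnectedSpace 𝔠.Glued := by
  obtain ⟨x⟩ : Nonempty N := inferInstance
  rw [connectedSpace_iff_univ, ← 𝔠.glueData.range_inl_union_range_inr]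
  refine (isConnected_range 𝔠.glueData.continuous_inl).union ⟨𝔠.inl (𝒟₁.embed x), ⟨_, rfl⟩, ?_⟩
    (isConnected_range 𝔠.glueData.continuous_inr)
  exact ⟨ι₂ x, (𝔠.inl_embed_eq_inr_embed x).symm⟩

end HypCommonDevelopment

end CauchyDevelopment

namespace CauchyDevelopment

namespace HypCommonDevelopment

variable {𝒟₁ : CauchyDevelopment D₁} {𝒟₂ : CauchyDevelopment D₂} {ι₂ : N → 𝒟₂.carrier}
  (𝔠 : HypCommonDevelopment 𝒟₁ 𝒟₂ ι₂)

/-- **The gluing map is an isometry** in the form required by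
`SmoothGlueData.exists_metric_of_glue_isometry`: `g'(dψ v, dψ w) = g(v, w)` on `U`.
[cite: Sbierski2016AHP, §3.3, proof of Thm. 5 ("the two metrics … agree since `ψ` is an isometry")] -/
theorem glue_isometry (a : 𝒟₁.carrier) (ha : a ∈ 𝔠.glueData.glue.source)
    (v w : TangentSpace (𝓡 (n + 1)) a) :
    𝒟₂.metric.toPseudoRiemannianMetric.val (𝔠.glueData.glue a)
        (mfderiv (𝓡 (n + 1)) (𝓡 (n + 1)) 𝔠.glueData.glue a v)
        (mfderiv (𝓡 (n + 1)) (𝓡 (n + 1)) 𝔠.glueData.glue a w) =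
      𝒟₁.metric.toPseudoRiemannianMetric.val a v w := by
  have ha' : a ∈ 𝔠.opens := by
    have h := ha
    rw [glueData_glue, glue_source] at h
    exact h
  have hd : mfderiv (𝓡 (n + 1)) (𝓡 (n + 1)) 𝔠.glueData.glue a =
      mfderiv (𝓡 (n + 1)) (𝓡 (n + 1)) 𝔠.map ⟨a, ha'⟩ := 𝔠.mfderiv_glue_eq ⟨a, ha'⟩
  have hp : 𝔠.glueData.glue a = 𝔠.map ⟨a, ha'⟩ := 𝔠.glue_apply ha'
  have h := congrArg (fun b ↦ b v w) (𝔠.isIsometricImmersion.2 ⟨a, ha'⟩)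
  simp only [pullbackBilin_apply] at h
  rw [hd]
  have hgen : ∀ p, p = 𝔠.map ⟨a, ha'⟩ →
      𝒟₂.metric.toPseudoRiemannianMetric.val p
        (mfderiv (𝓡 (n + 1)) (𝓡 (n + 1)) 𝔠.map ⟨a, ha'⟩ v)
        (mfderiv (𝓡 (n + 1)) (𝓡 (n + 1)) 𝔠.map ⟨a, ha'⟩ w) =
      𝒟₁.metric.toPseudoRiemannianMetric.val a v w := by
    rintro p rfl
    exact h
  exact hgen _ hp

/-- The pseudo-Riemannian metric of the glued space (a choice of the metric of
`SmoothGlueData.exists_metric_of_glue_isometry`). [cite: Sbierski2016AHP, §3.3, proof of Thm. 5 ("pushing forward `g` and `g'`")] -/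
def gluedPseudoMetric : PseudoRiemannianMetric 𝓘(ℝ, EuclideanSpace ℝ (Fin (n + 1))) ∞
    (EuclideanSpace ℝ (Fin (n + 1)))
    (TangentSpace 𝓘(ℝ, EuclideanSpace ℝ (Fin (n + 1))) : 𝔠.Glued → Type _) :=
  Classical.choose (𝔠.glueData.exists_metric_of_glue_isometry 𝒟₁.metric.toPseudoRiemannianMetric
    𝒟₂.metric.toPseudoRiemannianMetric 𝔠.glue_isometry)

/-- `inl^* g̃ = g` for the glued pseudo-Riemannian metric. [cite: Sbierski2016AHP, §3.3, proof of Thm. 5] -/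
theorem val_gluedPseudoMetric_inl (a : 𝒟₁.carrier) (v w : TangentSpace (𝓡 (n + 1)) a) :
    𝔠.gluedPseudoMetric.val (𝔠.inl a) (mfderiv (𝓡 (n + 1)) (𝓡 (n + 1)) 𝔠.inl a v)
      (mfderiv (𝓡 (n + 1)) (𝓡 (n + 1)) 𝔠.inl a w) = 𝒟₁.metric.val a v w :=
  (Classical.choose_spec (𝔠.glueData.exists_metric_of_glue_isometry
    𝒟₁.metric.toPseudoRiemannianMetric 𝒟₂.metric.toPseudoRiemannianMetric 𝔠.glue_isometry)).1 a v w

/-- `inr^* g̃ = g'` for the glued pseudo-Riemannian metric. [cite: Sbierski2016AHP, §3.3, proof of Thm. 5] -/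
theorem val_gluedPseudoMetric_inr (b : 𝒟₂.carrier) (v w : TangentSpace (𝓡 (n + 1)) b) :
    𝔠.gluedPseudoMetric.val (𝔠.inr b) (mfderiv (𝓡 (n + 1)) (𝓡 (n + 1)) 𝔠.inr b v)
      (mfderiv (𝓡 (n + 1)) (𝓡 (n + 1)) 𝔠.inr b w) = 𝒟₂.metric.val b v w :=
  (Classical.choose_spec (𝔠.glueData.exists_metric_of_glue_isometry
    𝒟₁.metric.toPseudoRiemannianMetric 𝒟₂.metric.toPseudoRiemannianMetric 𝔠.glue_isometry)).2 b v w

/-- The differential of `inl` is bijective. [folklore] -/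
theorem mfderiv_inl_bijective (a : 𝒟₁.carrier) :
    Bijective (mfderiv (𝓡 (n + 1)) (𝓡 (n + 1)) 𝔠.inl a) :=
  𝔠.glueData.mfderiv_inl_bijective a

/-- The differential of `inr` is bijective. [folklore] -/
theorem mfderiv_inr_bijective (b : 𝒟₂.carrier) :
    Bijective (mfderiv (𝓡 (n + 1)) (𝓡 (n + 1)) 𝔠.inr b) :=
  𝔠.glueData.mfderiv_inr_bijective b

/-- **The glued Lorentzian metric `g̃`** on `M̃` (Sbierski 2016, §3.3: *"we can endow `M̃` with a
smooth Lorentzian metric by pushing forward `g` and `g'`"*): the glued pseudo-Riemannian metric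
has Lorentzian signature, every tangent space of `M̃` being isometric to one of `M` or of `M'`
through the bijective differential of `inl` or `inr`. [cite: Sbierski2016AHP, §3.3, proof of Thm. 5 ("`M̃` has a natural smooth Lorentzian metric")] -/
def gluedMetric : LorentzianMetric (𝓡 (n + 1)) ∞ 𝔠.Glued where
  toPseudoRiemannianMetric := 𝔠.gluedPseudoMetric
  exists_timelike p := by
    obtain (⟨a, rfl⟩ | ⟨b, rfl⟩) := 𝔠.glueData.exists_inl_or_inr p
    · obtain ⟨v, hv⟩ := 𝒟₁.metric.exists_timelike a
      exact ⟨mfderiv (𝓡 (n + 1)) (𝓡 (n + 1)) 𝔠.inl a v, by rw [𝔠.val_gluedPseudoMetric_inl]; exact hv⟩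
    · obtain ⟨v, hv⟩ := 𝒟₂.metric.exists_timelike b
      exact ⟨mfderiv (𝓡 (n + 1)) (𝓡 (n + 1)) 𝔠.inr b v, by rw [𝔠.val_gluedPseudoMetric_inr]; exact hv⟩
  pos_of_orthogonal p V W hV hVW hW := by
    obtain (⟨a, rfl⟩ | ⟨b, rfl⟩) := 𝔠.glueData.exists_inl_or_inr p
    · obtain ⟨v, rfl⟩ := (𝔠.mfderiv_inl_bijective a).2 V
      obtain ⟨w, rfl⟩ := (𝔠.mfderiv_inl_bijective a).2 W
      have hw : w ≠ 0 := fun h ↦ hW (by rw [h, map_zero])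
      rw [𝔠.val_gluedPseudoMetric_inl] at hV hVW ⊢
      exact 𝒟₁.metric.pos_of_orthogonal a v w hV hVW hw
    · obtain ⟨v, rfl⟩ := (𝔠.mfderiv_inr_bijective b).2 V
      obtain ⟨w, rfl⟩ := (𝔠.mfderiv_inr_bijective b).2 W
      have hw : w ≠ 0 := fun h ↦ hW (by rw [h, map_zero])
      rw [𝔠.val_gluedPseudoMetric_inr] at hV hVW ⊢
      exact 𝒟₂.metric.pos_of_orthogonal b v w hV hVW hw

/-- `g̃(d(inl) v, d(inl) w) = g(v, w)`. [cite: Sbierski2016AHP, §3.3, proof of Thm. 5 ("this turns `π ∘ j` … into isometries")] -/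
theorem val_gluedMetric_inl (a : 𝒟₁.carrier) (v w : TangentSpace (𝓡 (n + 1)) a) :
    𝔠.gluedMetric.val (𝔠.inl a) (mfderiv (𝓡 (n + 1)) (𝓡 (n + 1)) 𝔠.inl a v)
      (mfderiv (𝓡 (n + 1)) (𝓡 (n + 1)) 𝔠.inl a w) = 𝒟₁.metric.val a v w :=
  𝔠.val_gluedPseudoMetric_inl a v w

/-- `g̃(d(inr) v, d(inr) w) = g'(v, w)`. [cite: Sbierski2016AHP, §3.3, proof of Thm. 5 ("this turns … `π ∘ j'` into isometries")] -/
theorem val_gluedMetric_inr (b : 𝒟₂.carrier) (v w : TangentSpace (𝓡 (n + 1)) b) :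
    𝔠.gluedMetric.val (𝔠.inr b) (mfderiv (𝓡 (n + 1)) (𝓡 (n + 1)) 𝔠.inr b v)
      (mfderiv (𝓡 (n + 1)) (𝓡 (n + 1)) 𝔠.inr b w) = 𝒟₂.metric.val b v w :=
  𝔠.val_gluedPseudoMetric_inr b v w

/-- **`π ∘ j : M → M̃` is an isometric immersion.** [cite: Sbierski2016AHP, §3.3, proof of Thm. 5 ("this turns `π ∘ j` and `π ∘ j'` into isometries")] -/
theorem isIsometricImmersion_inl :
    𝒟₁.metric.IsIsometricImmersion 𝔠.gluedMetric.toPseudoRiemannianMetric 𝔠.inl :=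
  ⟨𝔠.glueData.contMDiff_inl, fun a ↦ by
    ext v w
    rw [pullbackBilin_apply]
    exact 𝔠.val_gluedMetric_inl a v w⟩

/-- **`π ∘ j' : M' → M̃` is an isometric immersion.** [cite: Sbierski2016AHP, §3.3, proof of Thm. 5 ("this turns `π ∘ j` and `π ∘ j'` into isometries")] -/
theorem isIsometricImmersion_inr :
    𝒟₂.metric.IsIsometricImmersion 𝔠.gluedMetric.toPseudoRiemannianMetric 𝔠.inr :=
  ⟨𝔠.glueData.contMDiff_inr, fun b ↦ by
    ext v w
    rw [pullbackBilin_apply]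
    exact 𝔠.val_gluedMetric_inr b v w⟩

/-! ### The pushed-forward orienting fields lie in one timecone -/

/-- The orienting field of `M` pushed forward to `M̃` at `π j a`. [cite: Sbierski2016AHP, §3.3, proof of Thm. 5 ("pushing forward `T` … via `π ∘ j`")] -/
def inlVec (a : 𝒟₁.carrier) : EuclideanSpace ℝ (Fin (n + 1)) :=
  mfderiv (𝓡 (n + 1)) (𝓡 (n + 1)) 𝔠.inl a (𝒟₁.timeOrientation.vectorField a)

/-- The orienting field of `M'` pushed forward to `M̃` at `π j' b`. [cite: Sbierski2016AHP, §3.3, proof of Thm. 5 ("pushing forward … `T'` via … `π ∘ j'`")] -/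
def inrVec (b : 𝒟₂.carrier) : EuclideanSpace ℝ (Fin (n + 1)) :=
  mfderiv (𝓡 (n + 1)) (𝓡 (n + 1)) 𝔠.inr b (𝒟₂.timeOrientation.vectorField b)

/-- The pushed-forward orienting vector of `M` is timelike for `g̃`. [folklore] -/
theorem isTimelike_inlVec (a : 𝒟₁.carrier) :
    𝔠.gluedMetric.IsTimelike (x := 𝔠.inl a) (𝔠.inlVec a) := by
  change 𝔠.gluedMetric.val (𝔠.inl a) (𝔠.inlVec a) (𝔠.inlVec a) < 0
  rw [inlVec, 𝔠.val_gluedMetric_inl]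
  exact 𝒟₁.timeOrientation.isTimelike a

/-- The pushed-forward orienting vector of `M'` is timelike for `g̃`. [folklore] -/
theorem isTimelike_inrVec (b : 𝒟₂.carrier) :
    𝔠.gluedMetric.IsTimelike (x := 𝔠.inr b) (𝔠.inrVec b) := by
  change 𝔠.gluedMetric.val (𝔠.inr b) (𝔠.inrVec b) (𝔠.inrVec b) < 0
  rw [inrVec, 𝔠.val_gluedMetric_inr]
  exact 𝒟₂.timeOrientation.isTimelike b

/-- **The pushed-forward orienting fields of `M` and `M'` lie in the same timecone on the
overlap**: `g̃(d(π j) T_a, d(π j') T'_{ψ a}) < 0` for `a ∈ U` — `d(π j) T_a = d(π j') (dψ T_a)`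
(`inr ∘ ψ = inl` near `a`), `π j'` is an isometry, and `dψ T_a` is future-directed for `τ'`
because `ψ` preserves the time orientation. *"Since `ψ : U → M'` preserves the time orientation,
at each point `ψ_*(T|_U)` and `T'|_{ψ(U)}` lie in the same component of the set of all timelike
tangent vectors"* (Sbierski 2016, §3.3). [cite: Sbierski2016AHP, §3.3, proof of Thm. 5 (time orientation step)] -/
theorem val_inlVec_inrVec_neg (y : 𝔠.opens) :
    𝔠.gluedMetric.val (𝔠.inr (𝔠.map y)) (𝔠.inlVec y.1) (𝔠.inrVec (𝔠.map y)) < 0 := by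
  have hy : (y : 𝒟₁.carrier) ∈ 𝔠.glueData.glue.source := by
    rw [glueData_glue, glue_source]; exact y.2
  have h1 : 𝔠.inlVec y.1 = mfderiv (𝓡 (n + 1)) (𝓡 (n + 1)) 𝔠.inr (𝔠.map y)
      (mfderiv (𝓡 (n + 1)) (𝓡 (n + 1)) 𝔠.map y (𝒟₁.timeOrientation.vectorField y.1)) := by
    rw [inlVec]
    have h := 𝔠.glueData.mfderiv_inl_eq_mfderiv_inr_glue hy (𝒟₁.timeOrientation.vectorField y.1)
    rw [glueData_glue] at h
    rw [show 𝔠.inl = 𝔠.glueData.inl from rfl, h, 𝔠.mfderiv_glue_eq y]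
    -- transport of the base point `glue y = ψ y` of `d(inr)`
    have hp : 𝔠.glue y.1 = 𝔠.map y := 𝔠.glue_apply y.2
    have hgen : ∀ (b : 𝒟₂.carrier), b = 𝔠.map y → ∀ (v : EuclideanSpace ℝ (Fin (n + 1))),
        mfderiv (𝓡 (n + 1)) (𝓡 (n + 1)) 𝔠.glueData.inr b v =
          mfderiv (𝓡 (n + 1)) (𝓡 (n + 1)) 𝔠.inr (𝔠.map y) v := by
      rintro b rfl v
      rfl
    exact hgen _ hp _
  rw [h1, inrVec, 𝔠.val_gluedMetric_inr, 𝒟₂.metric.symm]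
  exact (𝔠.preservesTimeOrientation y).2


/-! ### The time orientation of the glued space and the glued spacetime -/

/-- **The cone compatibility in the form of `SmoothGlueData.exists_timeOrientation_of_glue`**:
on the gluing region `U`, `g̃(d(π j) T_a, d(π j') T'_{ψ a}) < 0` (`val_inlVec_inrVec_neg`,
transported to the base point `π j a = π j' (ψ a)`). [cite: Sbierski2016AHP, §3.3, proof of Thm. 5 (time orientation step)] -/
theorem cone_compat (a : 𝒟₁.carrier) (ha : a ∈ 𝔠.glueData.glue.source) :
    𝔠.gluedMetric.val (𝔠.glueData.inl a)
        (mfderiv (𝓡 (n + 1)) (𝓡 (n + 1)) 𝔠.glueData.inl a (𝒟₁.timeOrientation.vectorField a))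
        (mfderiv (𝓡 (n + 1)) (𝓡 (n + 1)) 𝔠.glueData.inr (𝔠.glueData.glue a)
          (𝒟₂.timeOrientation.vectorField (𝔠.glueData.glue a))) < 0 := by
  have ha' : a ∈ 𝔠.opens := by
    have h := ha
    rw [glueData_glue, glue_source] at h
    exact h
  have h := 𝔠.val_inlVec_inrVec_neg ⟨a, ha'⟩
  have hp : 𝔠.glueData.glue a = 𝔠.map ⟨a, ha'⟩ := 𝔠.glue_apply ha'
  have hq : 𝔠.inr (𝔠.map ⟨a, ha'⟩) = 𝔠.inl a := 𝔠.inr_map ⟨a, ha'⟩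
  have hgen : ∀ b : 𝒟₂.carrier, b = 𝔠.map ⟨a, ha'⟩ → ∀ p : 𝔠.Glued, p = 𝔠.inr (𝔠.map ⟨a, ha'⟩) →
      𝔠.gluedMetric.val p (𝔠.inlVec a)
        (mfderiv (𝓡 (n + 1)) (𝓡 (n + 1)) 𝔠.inr b (𝒟₂.timeOrientation.vectorField b)) < 0 := by
    rintro b rfl p rfl
    exact h
  exact hgen _ hp _ hq.symm

/-- **A time orientation of `(M̃, g̃)` making `π j`, `π j'` time-orientation preserving exists when
`M̃` is Hausdorff** (`SmoothGlueData.exists_timeOrientation_of_glue` with the cone compatibility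
`cone_compat`). [cite: Sbierski2016AHP, §3.3, proof of Thm. 5 ("`(M̃, g̃)` has a natural time orientation")] -/
theorem exists_timeOrientation [T2Space 𝔠.Glued] :
    ∃ τ : TimeOrientation 𝔠.gluedMetric,
      (∀ a, τ.IsFutureDirected (x := 𝔠.inl a) (𝔠.inlVec a)) ∧
        ∀ b, τ.IsFutureDirected (x := 𝔠.inr b) (𝔠.inrVec b) :=
  𝔠.glueData.exists_timeOrientation_of_glue 𝒟₁.timeOrientation 𝒟₂.timeOrientation 𝔠.gluedMetric
    𝔠.val_gluedMetric_inl 𝔠.val_gluedMetric_inr 𝔠.cone_compat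

/-- **The glued time orientation** `T̃` of `(M̃, g̃)`, for a common development without
corresponding boundary points (so that `M̃` is Hausdorff, `t2Space_glued`).
[cite: Sbierski2016AHP, §3.3, proof of Thm. 5 ("`(M̃, g̃)` has a natural time orientation")] -/
def gluedTimeOrientation (h : ¬ 𝔠.HasCorrespondingBoundaryPoints) : TimeOrientation 𝔠.gluedMetric :=
  haveI := 𝔠.t2Space_glued h
  Classical.choose 𝔠.exists_timeOrientation

/-- **`π j : M → M̃` preserves the time orientations.** [cite: Sbierski2016AHP, §3.3, proof of Thm. 5 (time orientation step)] -/
theorem preservesTimeOrientation_inl (h : ¬ 𝔠.HasCorrespondingBoundaryPoints) :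
    𝒟₁.timeOrientation.PreservesTimeOrientation 𝔠.inl (𝔠.gluedTimeOrientation h) := by
  haveI := 𝔠.t2Space_glued h
  exact fun a ↦ (Classical.choose_spec 𝔠.exists_timeOrientation).1 a

/-- **`π j' : M' → M̃` preserves the time orientations.** [cite: Sbierski2016AHP, §3.3, proof of Thm. 5 (time orientation step)] -/
theorem preservesTimeOrientation_inr (h : ¬ 𝔠.HasCorrespondingBoundaryPoints) :
    𝒟₂.timeOrientation.PreservesTimeOrientation 𝔠.inr (𝔠.gluedTimeOrientation h) := by
  haveI := 𝔠.t2Space_glued h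
  exact fun b ↦ (Classical.choose_spec 𝔠.exists_timeOrientation).2 b

/-- **The glued spacetime** `(M̃, g̃, T̃)`: connected, Hausdorff (no corresponding boundary
points), second countable, smooth `(n+1)`-manifold with the glued Lorentzian metric and time
orientation. Reducible, so that its instance projections reduce to the instances of `𝔠.Glued`
during unification. [cite: Sbierski2016AHP, §3.3, proof of Thm. 5] -/
@[reducible]
def gluedSpacetime (h : ¬ 𝔠.HasCorrespondingBoundaryPoints) : Spacetime.{u} (n + 1) where
  carrier := 𝔠.Glued
  t2Space := 𝔠.t2Space_glued h
  metric := 𝔠.gluedMetric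
  timeOrientation := 𝔠.gluedTimeOrientation h

/-- The carrier of the glued spacetime is the glued space. [folklore] -/
@[simp]
theorem gluedSpacetime_carrier (h : ¬ 𝔠.HasCorrespondingBoundaryPoints) :
    (𝔠.gluedSpacetime h).carrier = 𝔠.Glued := rfl

/-- `π j` is a time-orientation preserving isometric immersion of `M` into the glued spacetime.
[cite: Sbierski2016AHP, §3.3, proof of Thm. 5 ("it is an extension of `M` and `M'`")] -/
theorem isIsometricImmersion_inl_gluedSpacetime (h : ¬ 𝔠.HasCorrespondingBoundaryPoints) :
    𝒟₁.metric.IsIsometricImmersion (𝔠.gluedSpacetime h).metric.toPseudoRiemannianMetric 𝔠.inl ∧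
      𝒟₁.timeOrientation.PreservesTimeOrientation 𝔠.inl (𝔠.gluedSpacetime h).timeOrientation :=
  ⟨𝔠.isIsometricImmersion_inl, 𝔠.preservesTimeOrientation_inl h⟩

/-- `π j'` is a time-orientation preserving isometric immersion of `M'` into the glued spacetime.
[cite: Sbierski2016AHP, §3.3, proof of Thm. 5 ("it is an extension of `M` and `M'`")] -/
theorem isIsometricImmersion_inr_gluedSpacetime (h : ¬ 𝔠.HasCorrespondingBoundaryPoints) :
    𝒟₂.metric.IsIsometricImmersion (𝔠.gluedSpacetime h).metric.toPseudoRiemannianMetric 𝔠.inr ∧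
      𝒟₂.timeOrientation.PreservesTimeOrientation 𝔠.inr (𝔠.gluedSpacetime h).timeOrientation :=
  ⟨𝔠.isIsometricImmersion_inr, 𝔠.preservesTimeOrientation_inr h⟩

end HypCommonDevelopment

end CauchyDevelopment

namespace CauchyDevelopment

namespace HypCommonDevelopment

variable {𝒟₁ : CauchyDevelopment D₁} {𝒟₂ : CauchyDevelopment D₂} {ι₂ : N → 𝒟₂.carrier}
  (𝔠 : HypCommonDevelopment 𝒟₁ 𝒟₂ ι₂)

/-- `π j₁ : M₁ → M̃` is a local diffeomorphism (an isometric immersion between equidimensional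
Lorentzian manifolds). [folklore] -/
theorem isLocalDiffeomorph_inl : IsLocalDiffeomorph (𝓡 (n + 1)) (𝓡 (n + 1)) ∞ 𝔠.inl :=
  LorentzianMetric.isLocalDiffeomorph_of_isIsometricImmersion 𝔠.isIsometricImmersion_inl

/-- `π j₂ : M₂ → M̃` is a local diffeomorphism. [folklore] -/
theorem isLocalDiffeomorph_inr : IsLocalDiffeomorph (𝓡 (n + 1)) (𝓡 (n + 1)) ∞ 𝔠.inr :=
  LorentzianMetric.isLocalDiffeomorph_of_isIsometricImmersion 𝔠.isIsometricImmersion_inr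

/-- `Σ̃ ⊆ π j₂(M₂)`. [folklore] -/
theorem range_gluedEmbed_subset : range (𝔠.inr ∘ 𝒟₂.embed) ⊆ range 𝔠.inr := by
  rintro _ ⟨x, rfl⟩
  exact ⟨𝒟₂.embed x, rfl⟩

/-- `π j₁(ι₁(N)) = π j₂(ι₂(N)) ⊆ π j₂(M₂)`. [folklore] -/
theorem inl_embed_mem_range_inr (x : N) : 𝔠.inl (𝒟₁.embed x) ∈ range 𝔠.inr :=
  ⟨ι₂ x, (𝔠.inl_embed_eq_inr_embed x).symm⟩

variable {𝔠}

/-! ### Crossings of `Σ̃` by endless timelike curves of the glued spacetime -/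

/-- **A piece of an endless timelike curve of `M̃` inside `π j₂(M₂)` meets `Σ̃`, exactly once**
(lift to `M₂`, where `ι_X(X)` is a Cauchy hypersurface). [cite: Sbierski2016AHP, §3.3, proof of Thm. 5 (global hyperbolicity step)] -/
theorem crossing_inr (h : ¬ 𝔠.HasCorrespondingBoundaryPoints) {γ : ℝ → 𝔠.Glued} {s : Set ℝ}
    (hγ : 𝔠.gluedMetric.IsEndlessTimelikeCurve (𝔠.gluedTimeOrientation h) γ s) {t₀ : ℝ}
    (ht₀ : t₀ ∈ s) (hγt₀ : γ t₀ ∈ range 𝔠.inr) :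
    (∃ t ∈ connectedComponentIn (s ∩ γ ⁻¹' range 𝔠.inr) t₀, γ t ∈ range (𝔠.inr ∘ 𝒟₂.embed)) ∧
      ∀ t₁ ∈ connectedComponentIn (s ∩ γ ⁻¹' range 𝔠.inr) t₀,
        ∀ t₂ ∈ connectedComponentIn (s ∩ γ ⁻¹' range 𝔠.inr) t₀,
          γ t₁ ∈ range (𝔠.inr ∘ 𝒟₂.embed) → γ t₂ ∈ range (𝔠.inr ∘ 𝒟₂.embed) → t₁ = t₂ := by
  haveI := 𝔠.t2Space_glued h
  obtain ⟨δ, hδ, hδc⟩ := LorentzianMetric.exists_lift_isEndlessTimelikeCurve 𝒟₂.timeOrientation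
    (𝔠.gluedTimeOrientation h) 𝔠.isIsometricImmersion_inr (𝔠.preservesTimeOrientation_inr h)
    𝔠.glueData.inr_injective 𝔠.isLocalDiffeomorph_inr hγ ht₀ hγt₀
  have hmem : ∀ t ∈ connectedComponentIn (s ∩ γ ⁻¹' range 𝔠.inr) t₀,
      (γ t ∈ range (𝔠.inr ∘ 𝒟₂.embed) ↔ δ t ∈ range 𝒟₂.embed) := fun t ht ↦ by
    constructor
    · rintro ⟨x, hx⟩
      refine ⟨x, 𝔠.glueData.inr_injective ?_⟩
      change 𝔠.inr (𝒟₂.embed x) = 𝔠.inr (δ t)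
      rw [hδ t ht]
      exact hx
    · rintro ⟨x, hx⟩
      exact ⟨x, by change 𝔠.inr (𝒟₂.embed x) = γ t; rw [hx, hδ t ht]⟩
  refine ⟨?_, fun t₁ ht₁ t₂ ht₂ h₁ h₂ ↦ ?_⟩
  · obtain ⟨t, ⟨ht, hx⟩, -⟩ := 𝒟₂.isCauchyHypersurface δ _ hδc
    exact ⟨t, ht, (hmem t ht).2 hx⟩
  · exact LorentzianMetric.IsCauchyHypersurface.eq_of_mem_of_mem (WithTop.coe_le_coe.mpr le_top)
      𝒟₂.isCauchyHypersurface hδc.1 hδc.2.1 ht₁ ht₂ ((hmem t₁ ht₁).1 h₁) ((hmem t₂ ht₂).1 h₂)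

/-- **Existence of a crossing**: every endless timelike curve of the glued spacetime meets `Σ̃`.
If `γ t₀ ∈ π j₂(M₂)` this is `crossing_inr`; otherwise `γ t₀ ∈ π j₁(M₁)`, the piece through `t₀`
lifts to an endless timelike curve of `M₁`, which meets the Cauchy hypersurface `ι₁(N)` at a
parameter `t₁`, and `γ t₁ = π j₁ (ι₁ x) = π j₂ (ι₂ x) ∈ π j₂(M₂)`, so `crossing_inr` applies at
`t₁`. [cite: HawkingEllis1973CUP, §7.6, p. 250] -/
theorem exists_crossing (h : ¬ 𝔠.HasCorrespondingBoundaryPoints) {γ : ℝ → 𝔠.Glued} {s : Set ℝ}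
    (hγ : 𝔠.gluedMetric.IsEndlessTimelikeCurve (𝔠.gluedTimeOrientation h) γ s) :
    ∃ t ∈ s, γ t ∈ range (𝔠.inr ∘ 𝒟₂.embed) := by
  haveI := 𝔠.t2Space_glued h
  obtain ⟨t₀, ht₀⟩ := hγ.2.2.1.nonempty
  obtain (hl | hr) := (𝔠.glueData.range_inl_union_range_inr ▸ mem_univ (γ t₀) :
    γ t₀ ∈ range 𝔠.inl ∪ range 𝔠.inr)
  · obtain ⟨δ, hδ, hδc⟩ := LorentzianMetric.exists_lift_isEndlessTimelikeCurve 𝒟₁.timeOrientation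
      (𝔠.gluedTimeOrientation h) 𝔠.isIsometricImmersion_inl (𝔠.preservesTimeOrientation_inl h)
      𝔠.glueData.inl_injective 𝔠.isLocalDiffeomorph_inl hγ ht₀ hl
    obtain ⟨t₁, ⟨ht₁, x, hx⟩, -⟩ := 𝒟₁.isCauchyHypersurface δ _ hδc
    have ht₁s : t₁ ∈ s := (connectedComponentIn_subset _ _ ht₁).1
    have hγt₁ : γ t₁ ∈ range 𝔠.inr := by
      rw [← hδ t₁ ht₁, ← hx]
      exact 𝔠.inl_embed_mem_range_inr x
    obtain ⟨⟨t, ht, hx⟩, -⟩ := crossing_inr h hγ ht₁s hγt₁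
    exact ⟨t, (connectedComponentIn_subset _ _ ht).1, hx⟩
  · obtain ⟨⟨t, ht, hx⟩, -⟩ := crossing_inr h hγ ht₀ hr
    exact ⟨t, (connectedComponentIn_subset _ _ ht).1, hx⟩

/-! ### A real-variable lemma: leaving the first piece towards a parameter in the second -/

/-- **Exit lemma (to the right).** Let `A`, `B` be open sets covering `Z`, `γ : ℝ → Z` continuous
at the points of the interval `s`, `t' < t₃` in `s` with `γ t' ∈ A` and `γ t₃ ∈ B`. Then the
connected component `K` of `t'` in `{t ∈ s | γ t ∈ A}` contains a parameter `t ∈ (t', t₃]` with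
`γ t ∈ B`: otherwise the supremum `c` of the `t ≤ t₃` with `[t', t] ⊆ K` satisfies `γ c ∉ A`
(else `K` reaches beyond `c`, or `c = t₃` is such a parameter) and `γ c ∉ B` (else parameters of
`K` just below `c` are mapped into `B`). [folklore] -/
theorem exists_mem_connectedComponentIn_Ioc {Z : Type*} [TopologicalSpace Z] {A B : Set Z}
    (hA : IsOpen A) (hB : IsOpen B) (hAB : ∀ z, z ∈ A ∨ z ∈ B) {γ : ℝ → Z} {s : Set ℝ}
    (hs : s.OrdConnected) (hcont : ∀ t ∈ s, ContinuousAt γ t) {t' t₃ : ℝ} (ht' : t' ∈ s)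
    (ht₃ : t₃ ∈ s) (hlt : t' < t₃) (hγt' : γ t' ∈ A) (hγt₃ : γ t₃ ∈ B) :
    ∃ t ∈ connectedComponentIn (s ∩ γ ⁻¹' A) t', t' < t ∧ t ≤ t₃ ∧ γ t ∈ B := by
  by_contra H
  push Not at H
  set K := connectedComponentIn (s ∩ γ ⁻¹' A) t' with hK
  have hKsub : K ⊆ s ∩ γ ⁻¹' A := connectedComponentIn_subset _ _
  have ht'K : t' ∈ K := mem_connectedComponentIn ⟨ht', hγt'⟩
  have hIcc : Icc t' t₃ ⊆ s := hs.out ht' ht₃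
  -- neighbourhoods mapped into an open set
  have hnhd : ∀ c ∈ s, ∀ O : Set Z, IsOpen O → γ c ∈ O → ∃ ε > 0, ∀ t, |t - c| < ε → γ t ∈ O := by
    intro c hc O hO hγc
    obtain ⟨ε, hε, hball⟩ := Metric.mem_nhds_iff.1 ((hcont c hc).preimage_mem_nhds (hO.mem_nhds hγc))
    exact ⟨ε, hε, fun t ht ↦ hball (by rw [Metric.mem_ball, Real.dist_eq]; exact ht)⟩
  -- the set of good right end points and its supremum
  set P : Set ℝ := {t | t ∈ Icc t' t₃ ∧ Icc t' t ⊆ K} with hP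
  have ht'P : t' ∈ P := ⟨left_mem_Icc.2 hlt.le, by rw [Icc_self]; exact singleton_subset_iff.2 ht'K⟩
  have hPne : P.Nonempty := ⟨t', ht'P⟩
  have hPbdd : BddAbove P := ⟨t₃, fun t ht ↦ ht.1.2⟩
  set c := sSup P with hc
  have ht'c : t' ≤ c := le_csSup hPbdd ht'P
  have hct₃ : c ≤ t₃ := csSup_le hPne fun t ht ↦ ht.1.2
  have hcs : c ∈ s := hIcc ⟨ht'c, hct₃⟩
  -- `[t', c) ⊆ K`
  have hIco : Ico t' c ⊆ K := by
    intro t ht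
    obtain ⟨p, hp, htp⟩ := exists_lt_of_lt_csSup hPne ht.2
    exact hp.2 ⟨ht.1, htp.le⟩
  rcases hAB (γ c) with hcA | hcB
  · -- `γ c ∈ A`: then `c ∈ P`, and `K` reaches beyond `c` unless `c = t₃`
    have hcK : Icc t' c ⊆ K := by
      have hsub : Icc t' c ⊆ s ∩ γ ⁻¹' A := by
        intro t ht
        rcases eq_or_lt_of_le ht.2 with rfl | hlt'
        · exact ⟨hcs, hcA⟩
        · exact hKsub (hIco ⟨ht.1, hlt'⟩)
      exact isPreconnected_Icc.subset_connectedComponentIn (left_mem_Icc.2 ht'c) hsub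
    rcases eq_or_lt_of_le hct₃ with heq | hlt₃
    · -- `c = t₃`
      exact H t₃ (hcK (by rw [heq]; exact right_mem_Icc.2 (heq ▸ ht'c))) hlt le_rfl hγt₃
    · obtain ⟨ε, hε, hεA⟩ := hnhd c hcs A hA hcA
      set t := min (c + ε / 2) t₃ with ht
      have hct : c < t := lt_min (by linarith) hlt₃
      have htt₃ : t ≤ t₃ := min_le_right _ _
      have htP : t ∈ P := by
        refine ⟨⟨ht'c.trans hct.le, htt₃⟩, ?_⟩
        have hsub : Icc c t ⊆ s ∩ γ ⁻¹' A := fun u hu ↦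
          ⟨hIcc ⟨ht'c.trans hu.1, hu.2.trans htt₃⟩, hεA u (by
            rw [abs_lt]; constructor <;> linarith [hu.1, hu.2, min_le_left (c + ε / 2) t₃])⟩
        have hcomp : Icc c t ⊆ connectedComponentIn (s ∩ γ ⁻¹' A) c :=
          isPreconnected_Icc.subset_connectedComponentIn (left_mem_Icc.2 hct.le) hsub
        rw [← connectedComponentIn_eq (hcK (right_mem_Icc.2 ht'c))] at hcomp
        rw [← Icc_union_Icc_eq_Icc ht'c hct.le]
        exact union_subset hcK hcomp
      exact absurd (le_csSup hPbdd htP) (not_le.2 hct)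
  · -- `γ c ∈ B`: parameters of `K` just below `c` are mapped into `B`
    have ht'c' : t' < c := by
      refine lt_of_le_of_ne ht'c fun heq ↦ ?_
      -- `c = t'`: `γ t' ∈ A ∩ B`, and parameters of `K` just above `t'` are mapped into `B`
      obtain ⟨ε, hε, hεB⟩ := hnhd c hcs B hB hcB
      obtain ⟨ε', hε', hε'A⟩ := hnhd t' ht' A hA hγt'
      set t := min (t' + min ε ε' / 2) t₃ with ht
      have ht't : t' < t := lt_min (by linarith [lt_min hε hε']) hlt
      have htt₃ : t ≤ t₃ := min_le_right _ _
      have htK : t ∈ K := by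
        have hsub : Icc t' t ⊆ s ∩ γ ⁻¹' A := fun u hu ↦
          ⟨hIcc ⟨hu.1, hu.2.trans htt₃⟩, hε'A u (by
            rw [abs_lt]; constructor <;>
              linarith [hu.1, hu.2, min_le_left (t' + min ε ε' / 2) t₃, min_le_right ε ε',
                lt_min hε hε'])⟩
        exact isPreconnected_Icc.subset_connectedComponentIn (left_mem_Icc.2 ht't.le) hsub
          (right_mem_Icc.2 ht't.le)
      refine H t htK ht't htt₃ (hεB t ?_)
      rw [← heq, abs_lt]
      constructor <;>
        linarith [min_le_left (t' + min ε ε' / 2) t₃, min_le_left ε ε', lt_min hε hε']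
    obtain ⟨ε, hε, hεB⟩ := hnhd c hcs B hB hcB
    set t := max (c - ε / 2) ((t' + c) / 2) with ht
    have htc : t < c := max_lt (by linarith) (by linarith)
    have ht't : t' < t := lt_of_lt_of_le (by linarith) (le_max_right _ _)
    have htK : t ∈ K := hIco ⟨ht't.le, htc⟩
    refine H t htK ht't (htc.le.trans hct₃) (hεB t ?_)
    rw [abs_lt]
    constructor <;> linarith [le_max_left (c - ε / 2) ((t' + c) / 2)]

/-- **Exit lemma (to the left)**: the reflection `t ↦ -t` of
`exists_mem_connectedComponentIn_Ioc`. [folklore] -/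
theorem exists_mem_connectedComponentIn_Ico {Z : Type*} [TopologicalSpace Z] {A B : Set Z}
    (hA : IsOpen A) (hB : IsOpen B) (hAB : ∀ z, z ∈ A ∨ z ∈ B) {γ : ℝ → Z} {s : Set ℝ}
    (hs : s.OrdConnected) (hcont : ∀ t ∈ s, ContinuousAt γ t) {t₁ t' : ℝ} (ht₁ : t₁ ∈ s)
    (ht' : t' ∈ s) (hlt : t₁ < t') (hγt₁ : γ t₁ ∈ B) (hγt' : γ t' ∈ A) :
    ∃ t ∈ connectedComponentIn (s ∩ γ ⁻¹' A) t', t₁ ≤ t ∧ t < t' ∧ γ t ∈ B := by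
  set e := Homeomorph.neg ℝ with he
  have he' : ∀ u : ℝ, e u = -u := fun u ↦ rfl
  set s' : Set ℝ := e ⁻¹' s with hs'
  set γ' : ℝ → Z := γ ∘ e with hγ'
  have hs'o : s'.OrdConnected := ⟨fun a ha b hb u hu ↦ by
    change -u ∈ s
    exact hs.out hb ha ⟨by rw [he'] ; linarith [hu.2], by rw [he']; linarith [hu.1]⟩⟩
  have hcont' : ∀ u ∈ s', ContinuousAt γ' u := fun u hu ↦
    ContinuousAt.comp (hcont _ hu) e.continuous.continuousAt
  obtain ⟨u, hu, h1, h2, hB'⟩ := exists_mem_connectedComponentIn_Ioc hA hB hAB hs'o hcont'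
    (t' := -t') (t₃ := -t₁) (show -t' ∈ s' by change -(-t') ∈ s; rw [neg_neg]; exact ht')
    (show -t₁ ∈ s' by change -(-t₁) ∈ s; rw [neg_neg]; exact ht₁) (by linarith)
    (show γ (-(-t')) ∈ A by rw [neg_neg]; exact hγt') (show γ (-(-t₁)) ∈ B by rw [neg_neg]; exact hγt₁)
  refine ⟨-u, ?_, by linarith, by linarith, hB'⟩
  -- `-u` lies in the reflected component
  have himage : e '' connectedComponentIn (s' ∩ γ' ⁻¹' A) (-t') =
      connectedComponentIn (s ∩ γ ⁻¹' A) t' := by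
    rw [e.image_connectedComponentIn (show -t' ∈ s' ∩ γ' ⁻¹' A from
      ⟨show -(-t') ∈ s by rw [neg_neg]; exact ht', show γ (-(-t')) ∈ A by rw [neg_neg]; exact hγt'⟩)]
    congr 1
    · ext t
      simp only [mem_image, mem_inter_iff, mem_preimage, hγ', comp_apply, he']
      constructor
      · rintro ⟨v, ⟨hv, hvA⟩, rfl⟩
        exact ⟨hv, hvA⟩
      · rintro ⟨ht, htA⟩
        exact ⟨-t, ⟨by change -(-t) ∈ s; rw [neg_neg]; exact ht, by rw [neg_neg]; exact htA⟩,
          neg_neg t⟩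
    · rw [he', neg_neg]
  rw [← himage]
  exact ⟨u, hu, rfl⟩

/-! ### Uniqueness of the crossing -/

/-- **Two pieces of causal bookkeeping on the side of `M₁`.** For the lift `δ` of a piece of a
timelike curve of `M̃` inside `π j₁(M₁)` and a parameter `t⋆` of the piece with `δ t⋆ ∈ U`,
`δ t⋆ ∉ ι₁(N)`: if `δ t⋆ ∈ I⁺(ι₁ N)` in `M₁` then `δ t⋆ ∈ I⁺(ι₁ N)` in the sub-spacetime `U`
(the dichotomy `U ∖ ι₁(N) = I⁺_U ∪ I⁻_U` of the Cauchy hypersurface `ι₁(N)` of `U`, and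
`I⁻_U ⊆ I⁻_{M₁}` is disjoint from `I⁺_{M₁}`), hence `ψ (δ t⋆) ∈ I⁺(ι₂ N)` in `M₂` (transport
along `ψ`); and the time dual. [cite: ONeillSemiRiemannian1983, Ch. 14, Lemma 14.29 (p. 415)] -/
theorem map_mem_chronologicalFuture_of_mem (y : 𝔠.opens) (hyS : (y : 𝒟₁.carrier) ∉ range 𝒟₁.embed)
    (hy : (y : 𝒟₁.carrier) ∈ 𝒟₁.metric.chronologicalFuture 𝒟₁.timeOrientation (range 𝒟₁.embed)) :
    𝔠.map y ∈ 𝒟₂.metric.chronologicalFuture 𝒟₂.timeOrientation (range ι₂) := by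
  have hn2 : (2 : ℕ∞ω) ≤ ∞ := WithTop.coe_le_coe.mpr le_top
  have hyS' : y ∉ (Subtype.val ⁻¹' range 𝒟₁.embed : Set 𝔠.opens) := hyS
  rcases LorentzianMetric.IsCauchyHypersurface.mem_chronologicalFuture_union_chronologicalPast hn2
    𝔠.isCauchyHypersurface hyS' with hfut | hpast
  · -- transport the `U`-curve along `ψ`
    obtain ⟨z, ⟨x, hx⟩, β, a, b, hab, hβ, hβa, hβb⟩ := hfut
    have hβ₂ := LorentzianMetric.IsFutureTimelikeCurveOn.comp_isIsometricImmersion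
      (𝔠.contMDiff_map.mdifferentiable (by simp)) 𝔠.preservesTimeOrientation
      𝔠.isIsometricImmersion.2 hβ
    refine ⟨ι₂ x, ⟨x, rfl⟩, 𝔠.map ∘ β, a, b, hab, hβ₂, ?_, by rw [comp_apply, hβb]⟩
    rw [comp_apply, hβa, ← 𝔠.map_embedOpens x]
    congr 1
    exact Subtype.ext hx.symm
  · -- `y ∈ I⁻_U(ι₁ N)`: then `y ∈ I⁻_{M₁}(ι₁ N)`, against `y ∈ I⁺_{M₁}(ι₁ N)`
    exfalso
    rw [LorentzianMetric.chronologicalPast, LorentzianMetric.chronologicalFuture_eq_biUnion] at hpast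
    simp only [mem_iUnion, exists_prop] at hpast
    obtain ⟨z, ⟨x, hx⟩, hz⟩ := hpast
    -- `z ∈ I⁺_U(y)`, transported along the inclusion
    obtain ⟨y', hy', β, a, b, hab, hβ, hβa, hβb⟩ :=
      LorentzianMetric.mem_chronologicalFuture_of_mem_chronologicalPast hz
    rw [mem_singleton_iff] at hy'
    rw [hy'] at hβa
    have hβ₁ : 𝒟₁.metric.IsFutureTimelikeCurveOn 𝒟₁.timeOrientation (Subtype.val ∘ β) (Icc a b) :=
      (LorentzianMetric.isFutureTimelikeCurveOn_restrict_iff 𝒟₁.metric 𝒟₁.timeOrientation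
        PseudoRiemannianMetric.contMDiff_restrict_holds
        𝒟₁.timeOrientation.contMDiff_restrict_holds _).1 hβ
    have h1 : (z : 𝒟₁.carrier) ∈ 𝒟₁.metric.chronologicalFuture 𝒟₁.timeOrientation {(y : 𝒟₁.carrier)} :=
      ⟨y, rfl, Subtype.val ∘ β, a, b, hab, hβ₁, by rw [comp_apply, hβa], by rw [comp_apply, hβb]⟩
    have h2 : (y : 𝒟₁.carrier) ∈ 𝒟₁.metric.chronologicalPast 𝒟₁.timeOrientation (range 𝒟₁.embed) := by
      rw [LorentzianMetric.chronologicalPast, LorentzianMetric.chronologicalFuture_eq_biUnion]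
      simp only [mem_iUnion, exists_prop]
      exact ⟨z, ⟨x, hx⟩, LorentzianMetric.mem_chronologicalPast_of_mem_chronologicalFuture h1⟩
    exact Set.disjoint_left.1
      (LorentzianMetric.IsCauchyHypersurface.disjoint_chronologicalFuture_chronologicalPast hn2
        𝒟₁.isCauchyHypersurface) hy h2

/-- Time dual of `map_mem_chronologicalFuture_of_mem`: if `δ t⋆ ∈ U ∖ ι₁(N)` lies in
`I⁻(ι₁ N)` in `M₁`, then `ψ (δ t⋆) ∈ I⁻(ι₂ N)` in `M₂`, in the pointwise form
`ι₂ x ∈ I⁺(ψ (δ t⋆))`. [cite: ONeillSemiRiemannian1983, Ch. 14, Lemma 14.29 (p. 415)] -/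
theorem exists_mem_chronologicalFuture_map_of_mem (y : 𝔠.opens)
    (hyS : (y : 𝒟₁.carrier) ∉ range 𝒟₁.embed)
    (hy : (y : 𝒟₁.carrier) ∈ 𝒟₁.metric.chronologicalPast 𝒟₁.timeOrientation (range 𝒟₁.embed)) :
    ∃ x, ι₂ x ∈ 𝒟₂.metric.chronologicalFuture 𝒟₂.timeOrientation {𝔠.map y} := by
  have hn2 : (2 : ℕ∞ω) ≤ ∞ := WithTop.coe_le_coe.mpr le_top
  have hyS' : y ∉ (Subtype.val ⁻¹' range 𝒟₁.embed : Set 𝔠.opens) := hyS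
  rcases LorentzianMetric.IsCauchyHypersurface.mem_chronologicalFuture_union_chronologicalPast hn2
    𝔠.isCauchyHypersurface hyS' with hfut | hpast
  · -- `y ∈ I⁺_U(ι₁ N) ⊆ I⁺_{M₁}(ι₁ N)`, against `y ∈ I⁻_{M₁}(ι₁ N)`
    exfalso
    obtain ⟨z, ⟨x, hx⟩, β, a, b, hab, hβ, hβa, hβb⟩ := hfut
    have hβ₁ : 𝒟₁.metric.IsFutureTimelikeCurveOn 𝒟₁.timeOrientation (Subtype.val ∘ β) (Icc a b) :=
      (LorentzianMetric.isFutureTimelikeCurveOn_restrict_iff 𝒟₁.metric 𝒟₁.timeOrientation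
        PseudoRiemannianMetric.contMDiff_restrict_holds
        𝒟₁.timeOrientation.contMDiff_restrict_holds _).1 hβ
    have h1 : (y : 𝒟₁.carrier) ∈ 𝒟₁.metric.chronologicalFuture 𝒟₁.timeOrientation (range 𝒟₁.embed) :=
      ⟨z, ⟨x, hx⟩, Subtype.val ∘ β, a, b, hab, hβ₁, by rw [comp_apply, hβa], by rw [comp_apply, hβb]⟩
    exact Set.disjoint_left.1
      (LorentzianMetric.IsCauchyHypersurface.disjoint_chronologicalFuture_chronologicalPast hn2
        𝒟₁.isCauchyHypersurface) h1 hy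
  · rw [LorentzianMetric.chronologicalPast, LorentzianMetric.chronologicalFuture_eq_biUnion] at hpast
    simp only [mem_iUnion, exists_prop] at hpast
    obtain ⟨z, ⟨x, hx⟩, hz⟩ := hpast
    obtain ⟨y', hy', β, a, b, hab, hβ, hβa, hβb⟩ :=
      LorentzianMetric.mem_chronologicalFuture_of_mem_chronologicalPast hz
    rw [mem_singleton_iff] at hy'
    rw [hy'] at hβa
    have hβ₂ := LorentzianMetric.IsFutureTimelikeCurveOn.comp_isIsometricImmersion
      (𝔠.contMDiff_map.mdifferentiable (by simp)) 𝔠.preservesTimeOrientation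
      𝔠.isIsometricImmersion.2 hβ
    refine ⟨x, 𝔠.map y, rfl, 𝔠.map ∘ β, a, b, hab, hβ₂, by rw [comp_apply, hβa], ?_⟩
    rw [comp_apply, hβb, ← 𝔠.map_embedOpens x]
    congr 1
    exact Subtype.ext hx.symm

/-- **No two crossings.** Hypotheses: no corresponding boundary points (`M̃` Hausdorff);
(hD) `ψ(U) ⊆ D̃(ι₂ N)`: every endless timelike curve of `M₂` through a point of `ψ(U)` meets
`ι₂(N)`; (hac) `ι₂(N)` is achronal in `M₂`. Then an endless timelike curve `γ` of `M̃` does not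
meet `Σ̃ = π j₂(ι₂ X)` at two parameters `t₁ < t₃`. Proof. The two crossings lie on different
pieces of `γ` inside `π j₂(M₂)` (`crossing_inr`), so `γ t' ∉ π j₂(M₂)` for some `t' ∈ (t₁, t₃)`;
the piece `K ∋ t'` of `γ` inside `π j₁(M₁)` lifts to an endless timelike curve `δ` of `M₁`
crossing `ι₁(N)` once, at `t_K ≠ t'`. Say `t_K < t'` (the other case is the time dual, with `t₁`
in place of `t₃`). The exit lemma gives `t⋆ ∈ K ∩ (t', t₃]` with `γ t⋆ ∈ π j₂(M₂)`; the piece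
`J ∋ t⋆` inside `π j₂(M₂)` lies beyond `t'` and lifts to an endless timelike curve `ε` of `M₂`
with `ε = ψ ∘ δ` on `J ∩ K`. Since `δ t⋆ ∈ I⁺(ι₁ N) ∩ U`, `ε t⋆ = ψ (δ t⋆) ∈ I⁺(ι₂ N)`
(`map_mem_chronologicalFuture_of_mem`); by (hD) `ε` meets `ι₂(N)` at some `t_s ∈ J`: `t_s < t⋆`
puts `t_s ∈ (t', t⋆) ⊆ K` with `δ t_s ∈ ι₁(N)`, so `t_s = t_K < t'`, absurd; `t_s ≥ t⋆` gives two
chronologically related points of `ι₂(N)`, against (hac). [cite: HawkingEllis1973CUP, §7.6, p. 250] -/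
theorem not_two_crossings (h : ¬ 𝔠.HasCorrespondingBoundaryPoints)
    (hD : ∀ (y : 𝔠.opens) (γ : ℝ → 𝒟₂.carrier) (s : Set ℝ),
      𝒟₂.metric.IsEndlessTimelikeCurve 𝒟₂.timeOrientation γ s → (∃ t ∈ s, γ t = 𝔠.map y) →
      ∃ t ∈ s, γ t ∈ range ι₂)
    (hac : ∀ p ∈ range ι₂, ∀ q ∈ range ι₂,
      q ∉ 𝒟₂.metric.chronologicalFuture 𝒟₂.timeOrientation {p})
    {γ : ℝ → 𝔠.Glued} {s : Set ℝ}
    (hγ : 𝔠.gluedMetric.IsEndlessTimelikeCurve (𝔠.gluedTimeOrientation h) γ s)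
    {t₁ t₃ : ℝ} (hlt : t₁ < t₃) (ht₁ : t₁ ∈ s) (ht₃ : t₃ ∈ s)
    (h₁ : γ t₁ ∈ range (𝔠.inr ∘ 𝒟₂.embed)) (h₃ : γ t₃ ∈ range (𝔠.inr ∘ 𝒟₂.embed)) : False := by
  haveI := 𝔠.t2Space_glued h
  have hIcc : Icc t₁ t₃ ⊆ s := hγ.1.out ht₁ ht₃
  have hcont : ∀ t ∈ s, ContinuousAt γ t := fun t ht ↦ (hγ.2.1 t ht).1.continuousAt
  have hcover : ∀ z : 𝔠.Glued, z ∈ range 𝔠.inl ∨ z ∈ range 𝔠.inr := fun z ↦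
    (𝔠.glueData.range_inl_union_range_inr ▸ mem_univ z : z ∈ range 𝔠.inl ∪ range 𝔠.inr)
  -- achronality in the form used
  have hac' : ∀ q ∈ range ι₂, q ∉ 𝒟₂.metric.chronologicalFuture 𝒟₂.timeOrientation (range ι₂) := by
    intro q hq hqI
    rw [LorentzianMetric.chronologicalFuture_eq_biUnion] at hqI
    simp only [mem_iUnion, exists_prop] at hqI
    obtain ⟨p, hp, hpq⟩ := hqI
    exact hac p hp q hq hpq
  -- Step 1: a parameter `t' ∈ (t₁, t₃)` mapped outside `π j₂(M₂)`
  obtain ⟨t', ht', hγt'⟩ : ∃ t' ∈ Ioo t₁ t₃, γ t' ∉ range 𝔠.inr := by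
    by_contra H
    push Not at H
    have hsub : Icc t₁ t₃ ⊆ s ∩ γ ⁻¹' range 𝔠.inr := by
      intro t ht
      refine ⟨hIcc ht, ?_⟩
      rcases eq_or_lt_of_le ht.1 with heq | hlt₁
      · rw [← heq]; exact 𝔠.range_gluedEmbed_subset h₁
      rcases eq_or_lt_of_le ht.2 with heq | hlt₃
      · rw [heq]; exact 𝔠.range_gluedEmbed_subset h₃
      exact H t ⟨hlt₁, hlt₃⟩
    have h3mem : t₃ ∈ connectedComponentIn (s ∩ γ ⁻¹' range 𝔠.inr) t₁ :=
      isPreconnected_Icc.subset_connectedComponentIn (left_mem_Icc.2 hlt.le) hsub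
        (right_mem_Icc.2 hlt.le)
    have := (crossing_inr h hγ ht₁ (𝔠.range_gluedEmbed_subset h₁)).2 t₁
      (mem_connectedComponentIn ⟨ht₁, 𝔠.range_gluedEmbed_subset h₁⟩) t₃ h3mem h₁ h₃
    exact absurd this hlt.ne
  have ht's : t' ∈ s := hIcc ⟨ht'.1.le, ht'.2.le⟩
  have hγt'A : γ t' ∈ range 𝔠.inl := (hcover (γ t')).resolve_right hγt'
  -- Step 2: the piece `K ∋ t'` inside `π j₁(M₁)`, its lift `δ` and its crossing `t_K` of `ι₁(N)`
  set K := connectedComponentIn (s ∩ γ ⁻¹' range 𝔠.inl) t' with hKdef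
  have hKsub : K ⊆ s ∩ γ ⁻¹' range 𝔠.inl := connectedComponentIn_subset _ _
  have hKord : K.OrdConnected :=
    isPreconnected_iff_ordConnected.1 isPreconnected_connectedComponentIn
  have ht'K : t' ∈ K := mem_connectedComponentIn ⟨ht's, hγt'A⟩
  obtain ⟨δ, hδ, hδc⟩ := LorentzianMetric.exists_lift_isEndlessTimelikeCurve 𝒟₁.timeOrientation
    (𝔠.gluedTimeOrientation h) 𝔠.isIsometricImmersion_inl (𝔠.preservesTimeOrientation_inl h)
    𝔠.glueData.inl_injective 𝔠.isLocalDiffeomorph_inl hγ ht's hγt'A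
  obtain ⟨tK, ⟨htK, xK, hxK⟩, huniq⟩ := 𝒟₁.isCauchyHypersurface δ K hδc
  -- points of `K` mapped into `π j₂(M₂)` lift into `U`, compatibly with `ψ`
  have hU : ∀ t ∈ K, ∀ b : 𝒟₂.carrier, 𝔠.inr b = γ t →
      ∃ ht : δ t ∈ 𝔠.opens, 𝔠.map ⟨δ t, ht⟩ = b := by
    intro t ht b hb
    exact 𝔠.inl_eq_inr_iff.1 ((hδ t ht).trans hb.symm)
  -- crossings of `π j₁(ι₁ N) = π j₂(ι₂ N)` along `K` happen at `t_K` only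
  have hcrossK : ∀ t ∈ K, ∀ x', γ t = 𝔠.inr (ι₂ x') → t = tK := by
    intro t ht x' hx'
    refine huniq t ⟨ht, x', 𝔠.glueData.inl_injective ?_⟩
    change 𝔠.inl (𝒟₁.embed x') = 𝔠.inl (δ t)
    rw [hδ t ht, hx', inl_embed_eq_inr_embed]
  have htK_ne : tK ≠ t' := by
    intro heq
    apply hγt'
    rw [← heq, ← hδ tK htK, ← hxK]
    exact 𝔠.inl_embed_mem_range_inr xK
  have htKt'_not : ∀ t ∈ K, t ≠ tK → δ t ∉ range 𝒟₁.embed := fun t ht hne hmem ↦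
    hne (huniq t ⟨ht, hmem⟩)
  rcases lt_or_gt_of_ne htK_ne with hlt' | hgt'
  · /- Case `t_K < t'`: exit to the right, towards `t₃`. -/
    obtain ⟨tS, htSK, ht'tS, -, hγtS⟩ := exists_mem_connectedComponentIn_Ioc
      𝔠.glueData.isOpen_range_inl 𝔠.glueData.isOpen_range_inr hcover hγ.1 hcont ht's ht₃ ht'.2
      hγt'A (𝔠.range_gluedEmbed_subset h₃)
    have htSs : tS ∈ s := (hKsub htSK).1
    -- the piece `J ∋ t⋆` inside `π j₂(M₂)` and its lift `ε`
    set J := connectedComponentIn (s ∩ γ ⁻¹' range 𝔠.inr) tS with hJdef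
    have hJsub : J ⊆ s ∩ γ ⁻¹' range 𝔠.inr := connectedComponentIn_subset _ _
    have hJord : J.OrdConnected :=
      isPreconnected_iff_ordConnected.1 isPreconnected_connectedComponentIn
    have htSJ : tS ∈ J := mem_connectedComponentIn ⟨htSs, hγtS⟩
    have hJgt : ∀ t ∈ J, t' < t := by
      intro t ht
      by_contra hle
      exact hγt' (hJsub (hJord.out ht htSJ ⟨not_lt.1 hle, ht'tS.le⟩)).2
    obtain ⟨ε, hε, hεc⟩ := LorentzianMetric.exists_lift_isEndlessTimelikeCurve 𝒟₂.timeOrientation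
      (𝔠.gluedTimeOrientation h) 𝔠.isIsometricImmersion_inr (𝔠.preservesTimeOrientation_inr h)
      𝔠.glueData.inr_injective 𝔠.isLocalDiffeomorph_inr hγ htSs hγtS
    -- `δ t⋆ ∈ U` and `ψ (δ t⋆) = ε t⋆`
    obtain ⟨hUtS, hmaptS⟩ := hU tS htSK (ε tS) (hε tS htSJ)
    -- `δ t⋆ ∈ I⁺_{M₁}(ι₁ N)` (along `δ` from `t_K`), `δ t⋆ ∉ ι₁(N)`
    have hfutM : δ tS ∈ 𝒟₁.metric.chronologicalFuture 𝒟₁.timeOrientation (range 𝒟₁.embed) :=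
      ⟨δ tK, ⟨xK, hxK⟩, δ, tK, tS, hlt'.trans ht'tS, hδc.2.1.mono (hKord.out htK htSK), rfl, rfl⟩
    have hnotS : δ tS ∉ range 𝒟₁.embed := htKt'_not tS htSK (by
      rintro rfl; exact absurd (hlt'.trans ht'tS) (lt_irrefl _))
    -- transport: `ε t⋆ ∈ I⁺_{M₂}(ι₂ N)`
    have hεfut : ε tS ∈ 𝒟₂.metric.chronologicalFuture 𝒟₂.timeOrientation (range ι₂) := by
      rw [← hmaptS]
      exact map_mem_chronologicalFuture_of_mem ⟨δ tS, hUtS⟩ hnotS hfutM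
    -- (hD): `ε` meets `ι₂(N)` on `J`
    obtain ⟨ts, htsJ, x', hx'⟩ := hD ⟨δ tS, hUtS⟩ ε J hεc ⟨tS, htSJ, hmaptS.symm⟩
    rcases lt_trichotomy ts tS with hts | heq | hts
    · -- `t_s < t⋆`: then `t_s ∈ K` and `t_s = t_K < t'`, absurd
      have htsK : ts ∈ K := hKord.out ht'K htSK ⟨(hJgt ts htsJ).le, hts.le⟩
      have := hcrossK ts htsK x' (by rw [← hε ts htsJ, hx'])
      have h' := hJgt ts htsJ
      rw [this] at h'
      exact absurd (hlt'.trans h') (lt_irrefl _)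
    · -- `t_s = t⋆`: `ε t⋆ ∈ ι₂(N) ∩ I⁺(ι₂ N)`
      subst heq
      exact hac' (ε ts) ⟨x', hx'⟩ hεfut
    · -- `t_s > t⋆`: `ε t_s ∈ I⁺(ε t⋆) ⊆ I⁺(ι₂ N)`
      have h1 : ε ts ∈ 𝒟₂.metric.chronologicalFuture 𝒟₂.timeOrientation {ε tS} :=
        ⟨ε tS, rfl, ε, tS, ts, hts, hεc.2.1.mono (hJord.out htSJ htsJ), rfl, rfl⟩
      exact hac' (ε ts) ⟨x', hx'⟩ (LorentzianMetric.mem_chronologicalFuture_trans hεfut h1)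
  · /- Case `t' < t_K`: exit to the left, towards `t₁` (time dual). -/
    obtain ⟨tS, htSK, -, htSt', hγtS⟩ := exists_mem_connectedComponentIn_Ico
      𝔠.glueData.isOpen_range_inl 𝔠.glueData.isOpen_range_inr hcover hγ.1 hcont ht₁ ht's ht'.1
      (𝔠.range_gluedEmbed_subset h₁) hγt'A
    have htSs : tS ∈ s := (hKsub htSK).1
    set J := connectedComponentIn (s ∩ γ ⁻¹' range 𝔠.inr) tS with hJdef
    have hJsub : J ⊆ s ∩ γ ⁻¹' range 𝔠.inr := connectedComponentIn_subset _ _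
    have hJord : J.OrdConnected :=
      isPreconnected_iff_ordConnected.1 isPreconnected_connectedComponentIn
    have htSJ : tS ∈ J := mem_connectedComponentIn ⟨htSs, hγtS⟩
    have hJlt : ∀ t ∈ J, t < t' := by
      intro t ht
      by_contra hle
      exact hγt' (hJsub (hJord.out htSJ ht ⟨htSt'.le, not_lt.1 hle⟩)).2
    obtain ⟨ε, hε, hεc⟩ := LorentzianMetric.exists_lift_isEndlessTimelikeCurve 𝒟₂.timeOrientation
      (𝔠.gluedTimeOrientation h) 𝔠.isIsometricImmersion_inr (𝔠.preservesTimeOrientation_inr h)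
      𝔠.glueData.inr_injective 𝔠.isLocalDiffeomorph_inr hγ htSs hγtS
    obtain ⟨hUtS, hmaptS⟩ := hU tS htSK (ε tS) (hε tS htSJ)
    -- `δ t⋆ ∈ I⁻_{M₁}(ι₁ N)` (along `δ` up to `t_K`), `δ t⋆ ∉ ι₁(N)`
    have hpastM : δ tS ∈ 𝒟₁.metric.chronologicalPast 𝒟₁.timeOrientation (range 𝒟₁.embed) := by
      have h1 : δ tK ∈ 𝒟₁.metric.chronologicalFuture 𝒟₁.timeOrientation {δ tS} :=
        ⟨δ tS, rfl, δ, tS, tK, htSt'.trans hgt', hδc.2.1.mono (hKord.out htSK htK), rfl, rfl⟩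
      rw [LorentzianMetric.chronologicalPast, LorentzianMetric.chronologicalFuture_eq_biUnion]
      simp only [mem_iUnion, exists_prop]
      exact ⟨δ tK, ⟨xK, hxK⟩, LorentzianMetric.mem_chronologicalPast_of_mem_chronologicalFuture h1⟩
    have hnotS : δ tS ∉ range 𝒟₁.embed := htKt'_not tS htSK (by
      rintro rfl; exact absurd (htSt'.trans hgt') (lt_irrefl _))
    -- transport: `ι₂ x ∈ I⁺_{M₂}(ε t⋆)` for some `x`
    obtain ⟨x, hxfut⟩ := exists_mem_chronologicalFuture_map_of_mem ⟨δ tS, hUtS⟩ hnotS hpastM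
    rw [hmaptS] at hxfut
    -- (hD): `ε` meets `ι₂(N)` on `J`
    obtain ⟨ts, htsJ, x', hx'⟩ := hD ⟨δ tS, hUtS⟩ ε J hεc ⟨tS, htSJ, hmaptS.symm⟩
    rcases lt_trichotomy ts tS with hts | heq | hts
    · -- `t_s < t⋆`: `ε t⋆ ∈ I⁺(ε t_s) = I⁺(ι₂ x')`, so `ι₂ x ∈ I⁺(ι₂ x')`
      have h1 : ε tS ∈ 𝒟₂.metric.chronologicalFuture 𝒟₂.timeOrientation {ε ts} :=
        ⟨ε ts, rfl, ε, ts, tS, hts, hεc.2.1.mono (hJord.out htsJ htSJ), rfl, rfl⟩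
      rw [← hx'] at h1
      exact hac (ι₂ x') ⟨x', rfl⟩ (ι₂ x) ⟨x, rfl⟩
        (LorentzianMetric.mem_chronologicalFuture_trans h1 hxfut)
    · -- `t_s = t⋆`: `ι₂ x ∈ I⁺(ε t⋆) = I⁺(ι₂ x')`
      subst heq
      rw [← hx'] at hxfut
      exact hac (ι₂ x') ⟨x', rfl⟩ (ι₂ x) ⟨x, rfl⟩ hxfut
    · -- `t_s > t⋆`: then `t_s ∈ K` and `t_s = t_K > t'`, absurd
      have htsK : ts ∈ K := hKord.out htSK ht'K ⟨hts.le, (hJlt ts htsJ).le⟩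
      have := hcrossK ts htsK x' (by rw [← hε ts htsJ, hx'])
      have h' := hJlt ts htsJ
      rw [this] at h'
      exact absurd (h'.trans hgt') (lt_irrefl _)

/-- **`Σ̃ = π j₂(ι_X(X))` is a Cauchy hypersurface of the glued spacetime** `(M̃, g̃, T̃)`, for a
common development over `ι₂` of a Cauchy development of the data of the hypersurface `ι₂(N)`
and a Cauchy development `𝒟₂` in which `ι₂(N)` is achronal, realised over a region
`ψ(U) ⊆ D̃(ι₂ N)` of `M₂`, without corresponding boundary points: existence of a crossing is
`exists_crossing`, uniqueness `not_two_crossings`. [cite: HawkingEllis1973CUP, §7.6, p. 250] -/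
theorem isCauchyHypersurface_glued (h : ¬ 𝔠.HasCorrespondingBoundaryPoints)
    (hD : ∀ (y : 𝔠.opens) (γ : ℝ → 𝒟₂.carrier) (s : Set ℝ),
      𝒟₂.metric.IsEndlessTimelikeCurve 𝒟₂.timeOrientation γ s → (∃ t ∈ s, γ t = 𝔠.map y) →
      ∃ t ∈ s, γ t ∈ range ι₂)
    (hac : ∀ p ∈ range ι₂, ∀ q ∈ range ι₂,
      q ∉ 𝒟₂.metric.chronologicalFuture 𝒟₂.timeOrientation {p}) :
    𝔠.gluedMetric.IsCauchyHypersurface (𝔠.gluedTimeOrientation h) (range (𝔠.inr ∘ 𝒟₂.embed)) := by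
  intro γ s hγ
  obtain ⟨t, ht, hx⟩ := exists_crossing h hγ
  refine ⟨t, ⟨ht, hx⟩, fun t' ht' ↦ ?_⟩
  by_contra hne
  rcases lt_or_gt_of_ne hne with hlt | hlt
  · exact not_two_crossings h hD hac hγ hlt ht'.1 ht ht'.2 hx
  · exact not_two_crossings h hD hac hγ hlt ht ht'.1 hx ht'.2

end HypCommonDevelopment

end CauchyDevelopment

namespace CauchyDevelopment

namespace HypCommonDevelopment

variable {𝒟₁ : CauchyDevelopment D₁} {𝒟₂ : CauchyDevelopment D₂} {ι₂ : N → 𝒟₂.carrier}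
  (𝔠 : HypCommonDevelopment 𝒟₁ 𝒟₂ ι₂)

/-! ### The glued data embedding of the larger datum -/

/-- `π j₂` is differentiable. [folklore] -/
theorem mdifferentiable_inr : MDifferentiable (𝓡 (n + 1)) (𝓡 (n + 1)) 𝔠.inr :=
  𝔠.glueData.contMDiff_inr.mdifferentiable (by simp)

/-- `π j₁` is differentiable. [folklore] -/
theorem mdifferentiable_inl : MDifferentiable (𝓡 (n + 1)) (𝓡 (n + 1)) 𝔠.inl :=
  𝔠.glueData.contMDiff_inl.mdifferentiable (by simp)

/-- Chain rule for the glued data embedding `ι̃ = π j₂ ∘ ι_X`. [folklore] -/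
theorem mfderiv_inr_comp_embed (x : X) (v : TangentSpace (𝓡 n) x) :
    mfderiv (𝓡 n) (𝓡 (n + 1)) (𝔠.inr ∘ 𝒟₂.embed) x v =
      mfderiv (𝓡 (n + 1)) (𝓡 (n + 1)) 𝔠.inr (𝒟₂.embed x)
        (mfderiv (𝓡 n) (𝓡 (n + 1)) 𝒟₂.embed x v) := by
  rw [mfderiv_comp x (𝔠.mdifferentiable_inr _) (𝒟₂.mdifferentiable_embed x)]
  rfl

/-- `π j₂^* g̃ = g₂` as an equality of fields of bilinear forms. [cite: Sbierski2016AHP, §3.3, proof of Thm. 5 ("this turns `π ∘ j` … into isometries")] -/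
theorem pullbackBilin_inr_gluedMetric :
    pullbackBilin (I := 𝓡 (n + 1)) (I' := 𝓡 (n + 1)) 𝔠.inr 𝔠.gluedMetric.val = 𝒟₂.metric.val :=
  funext 𝔠.isIsometricImmersion_inr.2

/-- **The pull-back of the glued metric along `π j₂` is the metric of `𝒟₂`.** [cite: Sbierski2016AHP, §3.3, proof of Thm. 5] -/
theorem comap_gluedMetric_inr :
    𝔠.gluedMetric.toPseudoRiemannianMetric.comap PseudoRiemannianMetric.contMDiff_pullbackBilin_holds
      𝔠.inr 𝔠.glueData.contMDiff_inr (fun b ↦ (𝔠.mfderiv_inr_bijective b).1) rfl =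
      𝒟₂.metric.toPseudoRiemannianMetric :=
  PseudoRiemannianMetric.ext 𝔠.pullbackBilin_inr_gluedMetric

/-- **The pull-back of the glued metric along `π j₁` is the metric of `𝒟₁`.** [cite: Sbierski2016AHP, §3.3, proof of Thm. 5] -/
theorem comap_gluedMetric_inl :
    𝔠.gluedMetric.toPseudoRiemannianMetric.comap PseudoRiemannianMetric.contMDiff_pullbackBilin_holds
      𝔠.inl 𝔠.glueData.contMDiff_inl (fun a ↦ (𝔠.mfderiv_inl_bijective a).1) rfl =
      𝒟₁.metric.toPseudoRiemannianMetric :=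
  PseudoRiemannianMetric.ext (funext 𝔠.isIsometricImmersion_inl.2)

/-- **The glued data embedding** `(M̃, g̃, T̃, ι̃ = π j₂ ∘ ι_X, ν̃ = d(π j₂) ν₂)` of the larger datum
`D₂` on `X` (Hawking–Ellis 1973, §7.6, p. 250; `ι_X = 𝒟₂.embed`): a smooth embedding, with future
unit normal `d(π j₂) ν₂`, inducing `h₂` (`ι̃^* g̃ = ι_X^* (π j₂^* g̃) = ι_X^* g₂ = h₂`) and `k₂`
(naturality of the second fundamental form under the isometric immersion `π j₂`,
`PseudoRiemannianMetric.secondFundamentalForm_comap`, fed with the smoothness of `ν₂` along `ι_X`,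
`DataEmbedding.mdifferentiableAt_embed_normal`). Hypothesis: `U` has no corresponding boundary
points (`M̃` Hausdorff). [cite: HawkingEllis1973CUP, §7.6, p. 250] -/
def gluedDataEmbedding (h : ¬ 𝔠.HasCorrespondingBoundaryPoints) : DataEmbedding D₂ where
  toSpacetime := 𝔠.gluedSpacetime h
  embed := 𝔠.inr ∘ 𝒟₂.embed
  isSmoothEmbedding := 𝔠.glueData.isSmoothEmbedding_inr_comp 𝒟₂.isSmoothEmbedding
  normal := fun x ↦ mfderiv (𝓡 (n + 1)) (𝓡 (n + 1)) 𝔠.inr (𝒟₂.embed x) (𝒟₂.normal x)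
  isFutureUnitNormal := by
    refine ⟨⟨fun y v ↦ ?_, fun y ↦ ?_⟩, fun y ↦ ?_⟩
    · change 𝔠.gluedMetric.val (𝔠.inr (𝒟₂.embed y))
        (mfderiv (𝓡 (n + 1)) (𝓡 (n + 1)) 𝔠.inr (𝒟₂.embed y) (𝒟₂.normal y))
        (mfderiv (𝓡 n) (𝓡 (n + 1)) (𝔠.inr ∘ 𝒟₂.embed) y v) = 0
      rw [𝔠.mfderiv_inr_comp_embed, 𝔠.val_gluedMetric_inr]
      exact 𝒟₂.isFutureUnitNormal.1.1 y v
    · change 𝔠.gluedMetric.val (𝔠.inr (𝒟₂.embed y))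
        (mfderiv (𝓡 (n + 1)) (𝓡 (n + 1)) 𝔠.inr (𝒟₂.embed y) (𝒟₂.normal y))
        (mfderiv (𝓡 (n + 1)) (𝓡 (n + 1)) 𝔠.inr (𝒟₂.embed y) (𝒟₂.normal y)) = -1
      rw [𝔠.val_gluedMetric_inr]
      exact 𝒟₂.isFutureUnitNormal.1.2 y
    · exact (𝔠.preservesTimeOrientation_inr h).isFutureDirected_mfderiv
        𝔠.isIsometricImmersion_inr.2 (𝒟₂.isFutureUnitNormal.2 y)
  induced_h := fun y ↦ by
    change pullbackBilin (I := 𝓡 (n + 1)) (I' := 𝓡 n) (𝔠.inr ∘ 𝒟₂.embed) 𝔠.gluedMetric.val y =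
      D₂.h.inner y
    rw [pullbackBilin_comp 𝔠.mdifferentiable_inr 𝒟₂.mdifferentiable_embed,
      𝔠.pullbackBilin_inr_gluedMetric]
    exact 𝒟₂.induced_h y
  induced_k := by
    intro inst y
    haveI hLC : 𝒟₂.metric.toPseudoRiemannianMetric.HasLeviCivita :=
      𝒟₂.metric.toPseudoRiemannianMetric.hasLeviCivita
    haveI hgcLC : (𝔠.gluedMetric.toPseudoRiemannianMetric.comap
        PseudoRiemannianMetric.contMDiff_pullbackBilin_holds 𝔠.inr 𝔠.glueData.contMDiff_inr
        (fun b ↦ (𝔠.mfderiv_inr_bijective b).1) rfl).HasLeviCivita :=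
      PseudoRiemannianMetric.hasLeviCivita _
    have key := PseudoRiemannianMetric.secondFundamentalForm_comap
      𝔠.gluedMetric.toPseudoRiemannianMetric PseudoRiemannianMetric.contMDiff_pullbackBilin_holds
      (Φ := 𝔠.inr) 𝔠.glueData.contMDiff_inr (fun b ↦ (𝔠.mfderiv_inr_bijective b).1) rfl
      (f := 𝒟₂.embed) (ν := 𝒟₂.normal) (y := y) BoundarylessManifold.isInteriorPoint
      (𝒟₂.toDataEmbedding.mdifferentiableAt_embed_normal y)
    change 𝔠.gluedMetric.toPseudoRiemannianMetric.secondFundamentalForm (𝓡 n) (𝔠.inr ∘ 𝒟₂.embed)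
      (fun x ↦ mfderiv (𝓡 (n + 1)) (𝓡 (n + 1)) 𝔠.inr (𝒟₂.embed x) (𝒟₂.normal x)) y = D₂.kBilin y
    rw [← key, PseudoRiemannianMetric.secondFundamentalForm_congr_metric 𝔠.comap_gluedMetric_inr
      hgcLC hLC]
    exact 𝒟₂.induced_k y

/-- **The glued Cauchy development** of `D₂`: the glued data embedding, whose data hypersurface
`Σ̃ = π j₂(ι_X(X))` is a Cauchy hypersurface of `(M̃, g̃, T̃)` (`isCauchyHypersurface_glued`, under
(hD) `ψ(U) ⊆ D̃(ι₂ N)` and (hac) achronality of `ι₂(N)`). Hawking–Ellis 1973, §7.6, p. 250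
(*"`𝓜⁺ … ` would then be a development of `𝓢`"*). [cite: HawkingEllis1973CUP, §7.6, p. 250] -/
def gluedCauchyDevelopment (h : ¬ 𝔠.HasCorrespondingBoundaryPoints)
    (hD : ∀ (y : 𝔠.opens) (γ : ℝ → 𝒟₂.carrier) (s : Set ℝ),
      𝒟₂.metric.IsEndlessTimelikeCurve 𝒟₂.timeOrientation γ s → (∃ t ∈ s, γ t = 𝔠.map y) →
      ∃ t ∈ s, γ t ∈ range ι₂)
    (hac : ∀ p ∈ range ι₂, ∀ q ∈ range ι₂,
      q ∉ 𝒟₂.metric.chronologicalFuture 𝒟₂.timeOrientation {p}) : CauchyDevelopment D₂ where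
  toDataEmbedding := 𝔠.gluedDataEmbedding h
  isCauchyHypersurface := 𝔠.isCauchyHypersurface_glued h hD hac

/-- `π j₂` as a map into the carrier of the glued development (so that statements about it
elaborate against the development's bundled instances). [folklore] -/
def inrZ (h : ¬ 𝔠.HasCorrespondingBoundaryPoints)
    (hD : ∀ (y : 𝔠.opens) (γ : ℝ → 𝒟₂.carrier) (s : Set ℝ),
      𝒟₂.metric.IsEndlessTimelikeCurve 𝒟₂.timeOrientation γ s → (∃ t ∈ s, γ t = 𝔠.map y) →
      ∃ t ∈ s, γ t ∈ range ι₂)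
    (hac : ∀ p ∈ range ι₂, ∀ q ∈ range ι₂,
      q ∉ 𝒟₂.metric.chronologicalFuture 𝒟₂.timeOrientation {p}) :
    𝒟₂.carrier → (𝔠.gluedCauchyDevelopment h hD hac).carrier := 𝔠.inr

/-- `π j₁` as a map into the carrier of the glued development. [folklore] -/
def inlZ (h : ¬ 𝔠.HasCorrespondingBoundaryPoints)
    (hD : ∀ (y : 𝔠.opens) (γ : ℝ → 𝒟₂.carrier) (s : Set ℝ),
      𝒟₂.metric.IsEndlessTimelikeCurve 𝒟₂.timeOrientation γ s → (∃ t ∈ s, γ t = 𝔠.map y) →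
      ∃ t ∈ s, γ t ∈ range ι₂)
    (hac : ∀ p ∈ range ι₂, ∀ q ∈ range ι₂,
      q ∉ 𝒟₂.metric.chronologicalFuture 𝒟₂.timeOrientation {p}) :
    𝒟₁.carrier → (𝔠.gluedCauchyDevelopment h hD hac).carrier := 𝔠.inl

/-- `inrZ = π j₂`. [folklore] -/
@[simp]
theorem inrZ_apply (h : ¬ 𝔠.HasCorrespondingBoundaryPoints)
    (hD : ∀ (y : 𝔠.opens) (γ : ℝ → 𝒟₂.carrier) (s : Set ℝ),
      𝒟₂.metric.IsEndlessTimelikeCurve 𝒟₂.timeOrientation γ s → (∃ t ∈ s, γ t = 𝔠.map y) →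
      ∃ t ∈ s, γ t ∈ range ι₂)
    (hac : ∀ p ∈ range ι₂, ∀ q ∈ range ι₂,
      q ∉ 𝒟₂.metric.chronologicalFuture 𝒟₂.timeOrientation {p}) (b : 𝒟₂.carrier) :
    𝔠.inrZ h hD hac b = 𝔠.inr b := rfl

/-- `inlZ = π j₁`. [folklore] -/
@[simp]
theorem inlZ_apply (h : ¬ 𝔠.HasCorrespondingBoundaryPoints)
    (hD : ∀ (y : 𝔠.opens) (γ : ℝ → 𝒟₂.carrier) (s : Set ℝ),
      𝒟₂.metric.IsEndlessTimelikeCurve 𝒟₂.timeOrientation γ s → (∃ t ∈ s, γ t = 𝔠.map y) →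
      ∃ t ∈ s, γ t ∈ range ι₂)
    (hac : ∀ p ∈ range ι₂, ∀ q ∈ range ι₂,
      q ∉ 𝒟₂.metric.chronologicalFuture 𝒟₂.timeOrientation {p}) (a : 𝒟₁.carrier) :
    𝔠.inlZ h hD hac a = 𝔠.inl a := rfl

/-- **`π j₂` embeds `𝒟₂` into the glued development** (smooth open embedding, isometric,
time-orientation preserving, `π j₂ ∘ ι_X = ι̃`). [cite: HawkingEllis1973CUP, §7.6, p. 250] -/
theorem inrZ_embeds (h : ¬ 𝔠.HasCorrespondingBoundaryPoints)
    (hD : ∀ (y : 𝔠.opens) (γ : ℝ → 𝒟₂.carrier) (s : Set ℝ),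
      𝒟₂.metric.IsEndlessTimelikeCurve 𝒟₂.timeOrientation γ s → (∃ t ∈ s, γ t = 𝔠.map y) →
      ∃ t ∈ s, γ t ∈ range ι₂)
    (hac : ∀ p ∈ range ι₂, ∀ q ∈ range ι₂,
      q ∉ 𝒟₂.metric.chronologicalFuture 𝒟₂.timeOrientation {p}) :
    ContMDiff (𝓡 (n + 1)) (𝓡 (n + 1)) ∞ (𝔠.inrZ h hD hac) ∧ IsOpenEmbedding (𝔠.inrZ h hD hac) ∧
      𝒟₂.metric.IsIsometricImmersion (𝔠.gluedCauchyDevelopment h hD hac).metric.toPseudoRiemannianMetric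
        (𝔠.inrZ h hD hac) ∧
      𝒟₂.timeOrientation.PreservesTimeOrientation (𝔠.inrZ h hD hac)
        (𝔠.gluedCauchyDevelopment h hD hac).timeOrientation ∧
      𝔠.inrZ h hD hac ∘ 𝒟₂.embed = (𝔠.gluedCauchyDevelopment h hD hac).embed :=
  ⟨𝔠.glueData.contMDiff_inr, 𝔠.glueData.isOpenEmbedding_inr, 𝔠.isIsometricImmersion_inr,
    𝔠.preservesTimeOrientation_inr h, rfl⟩

/-- **`𝒟₂` embeds into the glued development** via `π j₂`. [cite: HawkingEllis1973CUP, §7.6, p. 250] -/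
theorem embedsInto_glued (h : ¬ 𝔠.HasCorrespondingBoundaryPoints)
    (hD : ∀ (y : 𝔠.opens) (γ : ℝ → 𝒟₂.carrier) (s : Set ℝ),
      𝒟₂.metric.IsEndlessTimelikeCurve 𝒟₂.timeOrientation γ s → (∃ t ∈ s, γ t = 𝔠.map y) →
      ∃ t ∈ s, γ t ∈ range ι₂)
    (hac : ∀ p ∈ range ι₂, ∀ q ∈ range ι₂,
      q ∉ 𝒟₂.metric.chronologicalFuture 𝒟₂.timeOrientation {p}) :
    𝒟₂.EmbedsInto (𝔠.gluedCauchyDevelopment h hD hac) :=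
  ⟨𝔠.inrZ h hD hac, 𝔠.inrZ_embeds h hD hac⟩

/-- **`π j₁ : M₁ → M̃` is a smooth isometric time-orientation preserving open embedding over
`ι₂`** into the glued development: `π j₁ ∘ ι₁ = π j₂ ∘ ι₂` (`inl_embed_eq_inr_embed`).
[cite: HawkingEllis1973CUP, §7.6, p. 250] -/
theorem inlZ_relative (h : ¬ 𝔠.HasCorrespondingBoundaryPoints)
    (hD : ∀ (y : 𝔠.opens) (γ : ℝ → 𝒟₂.carrier) (s : Set ℝ),
      𝒟₂.metric.IsEndlessTimelikeCurve 𝒟₂.timeOrientation γ s → (∃ t ∈ s, γ t = 𝔠.map y) →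
      ∃ t ∈ s, γ t ∈ range ι₂)
    (hac : ∀ p ∈ range ι₂, ∀ q ∈ range ι₂,
      q ∉ 𝒟₂.metric.chronologicalFuture 𝒟₂.timeOrientation {p}) :
    ContMDiff (𝓡 (n + 1)) (𝓡 (n + 1)) ∞ (𝔠.inlZ h hD hac) ∧ IsOpenEmbedding (𝔠.inlZ h hD hac) ∧
      𝒟₁.metric.IsIsometricImmersion (𝔠.gluedCauchyDevelopment h hD hac).metric.toPseudoRiemannianMetric
        (𝔠.inlZ h hD hac) ∧
      𝒟₁.timeOrientation.PreservesTimeOrientation (𝔠.inlZ h hD hac)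
        (𝔠.gluedCauchyDevelopment h hD hac).timeOrientation ∧
      𝔠.inlZ h hD hac ∘ 𝒟₁.embed = 𝔠.inrZ h hD hac ∘ ι₂ :=
  ⟨𝔠.glueData.contMDiff_inl, 𝔠.glueData.isOpenEmbedding_inl, 𝔠.isIsometricImmersion_inl,
    𝔠.preservesTimeOrientation_inl h, funext fun x ↦ 𝔠.inl_embed_eq_inr_embed x⟩

/-- **`π j₁` extends `ψ`**: `π j₁ y = π j₂ (ψ y)` for `y ∈ U`. [cite: Sbierski2016AHP, §3.3, proof of Thm. 5 (the identification `p ∼ ψ(p)`)] -/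
theorem inlZ_coe_eq_inrZ_map (h : ¬ 𝔠.HasCorrespondingBoundaryPoints)
    (hD : ∀ (y : 𝔠.opens) (γ : ℝ → 𝒟₂.carrier) (s : Set ℝ),
      𝒟₂.metric.IsEndlessTimelikeCurve 𝒟₂.timeOrientation γ s → (∃ t ∈ s, γ t = 𝔠.map y) →
      ∃ t ∈ s, γ t ∈ range ι₂)
    (hac : ∀ p ∈ range ι₂, ∀ q ∈ range ι₂,
      q ∉ 𝒟₂.metric.chronologicalFuture 𝒟₂.timeOrientation {p}) (y : 𝔠.opens) :
    𝔠.inlZ h hD hac y = 𝔠.inrZ h hD hac (𝔠.map y) :=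
  (𝔠.inr_map y).symm

/-! ### Vacuum -/

/-- **The glued metric is Ricci flat when `g₁` and `g₂` are** (naturality of the Ricci tensor
under the local isometries `π j₁`, `π j₂`, `PseudoRiemannianMetric.ricci_comap_apply`, whose
differentials are onto). [cite: Sbierski2016AHP, §3.3, proof of Thm. 5 ("Ricci-flat metric `g̃` on `M̃`")] -/
theorem isRicciFlat_gluedMetric (h₁ : 𝒟₁.toDataEmbedding.IsVacuum) (h₂ : 𝒟₂.toDataEmbedding.IsVacuum)
    [𝔠.gluedMetric.toPseudoRiemannianMetric.HasLeviCivita] :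
    𝔠.gluedMetric.toPseudoRiemannianMetric.IsRicciFlat := by
  intro p
  haveI hLC : 𝒟₁.metric.toPseudoRiemannianMetric.HasLeviCivita :=
    𝒟₁.metric.toPseudoRiemannianMetric.hasLeviCivita
  haveI hLC' : 𝒟₂.metric.toPseudoRiemannianMetric.HasLeviCivita :=
    𝒟₂.metric.toPseudoRiemannianMetric.hasLeviCivita
  obtain (⟨a, rfl⟩ | ⟨b, rfl⟩) := 𝔠.glueData.exists_inl_or_inr p
  · set gc := 𝔠.gluedMetric.toPseudoRiemannianMetric.comap
      PseudoRiemannianMetric.contMDiff_pullbackBilin_holds 𝔠.inl 𝔠.glueData.contMDiff_inl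
      (fun a ↦ (𝔠.mfderiv_inl_bijective a).1) rfl with hgc_def
    haveI hgcLC : gc.HasLeviCivita := gc.hasLeviCivita
    have hgc : gc = 𝒟₁.metric.toPseudoRiemannianMetric := 𝔠.comap_gluedMetric_inl
    refine LinearMap.ext fun V ↦ LinearMap.ext fun W ↦ ?_
    obtain ⟨Y₀, rfl⟩ := (𝔠.mfderiv_inl_bijective a).2 V
    obtain ⟨Z₀, rfl⟩ := (𝔠.mfderiv_inl_bijective a).2 W
    have key := PseudoRiemannianMetric.ricci_comap_apply 𝔠.gluedMetric.toPseudoRiemannianMetric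
      PseudoRiemannianMetric.contMDiff_pullbackBilin_holds (Φ := 𝔠.inl) 𝔠.glueData.contMDiff_inl
      (fun a ↦ (𝔠.mfderiv_inl_bijective a).1) rfl a Y₀ Z₀
    change 𝔠.gluedMetric.toPseudoRiemannianMetric.ricci (𝔠.inl a)
      (mfderiv (𝓡 (n + 1)) (𝓡 (n + 1)) 𝔠.inl a Y₀) (mfderiv (𝓡 (n + 1)) (𝓡 (n + 1)) 𝔠.inl a Z₀) = 0
    rw [← key, PseudoRiemannianMetric.ricci_congr_metric hgc hgcLC hLC, h₁ a]
    rfl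
  · set gc := 𝔠.gluedMetric.toPseudoRiemannianMetric.comap
      PseudoRiemannianMetric.contMDiff_pullbackBilin_holds 𝔠.inr 𝔠.glueData.contMDiff_inr
      (fun b ↦ (𝔠.mfderiv_inr_bijective b).1) rfl with hgc_def
    haveI hgcLC : gc.HasLeviCivita := gc.hasLeviCivita
    have hgc : gc = 𝒟₂.metric.toPseudoRiemannianMetric := 𝔠.comap_gluedMetric_inr
    refine LinearMap.ext fun V ↦ LinearMap.ext fun W ↦ ?_
    obtain ⟨Y₀, rfl⟩ := (𝔠.mfderiv_inr_bijective b).2 V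
    obtain ⟨Z₀, rfl⟩ := (𝔠.mfderiv_inr_bijective b).2 W
    have key := PseudoRiemannianMetric.ricci_comap_apply 𝔠.gluedMetric.toPseudoRiemannianMetric
      PseudoRiemannianMetric.contMDiff_pullbackBilin_holds (Φ := 𝔠.inr) 𝔠.glueData.contMDiff_inr
      (fun b ↦ (𝔠.mfderiv_inr_bijective b).1) rfl b Y₀ Z₀
    change 𝔠.gluedMetric.toPseudoRiemannianMetric.ricci (𝔠.inr b)
      (mfderiv (𝓡 (n + 1)) (𝓡 (n + 1)) 𝔠.inr b Y₀) (mfderiv (𝓡 (n + 1)) (𝓡 (n + 1)) 𝔠.inr b Z₀) = 0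
    rw [← key, PseudoRiemannianMetric.ricci_congr_metric hgc hgcLC hLC', h₂ b]
    rfl

end HypCommonDevelopment

end CauchyDevelopment

/-! ### Vacuum developments: the gluing input of the localisation principle -/

namespace VacuumCauchyDevelopment

/-- **The glued vacuum Cauchy development** of the larger datum, from a vacuum development of a
hypersurface datum and a vacuum development of the datum glued along a common development over `ι₂`
without
corresponding boundary points. [cite: HawkingEllis1973CUP, §7.6, p. 250] -/
def hypGluedVacuumCauchyDevelopment (𝒟₁ : VacuumCauchyDevelopment D₁)
    (𝒟₂ : VacuumCauchyDevelopment D₂) {ι₂ : N → 𝒟₂.carrier}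
    (𝔠 : CauchyDevelopment.HypCommonDevelopment 𝒟₁.toCauchyDevelopment 𝒟₂.toCauchyDevelopment ι₂)
    (h : ¬ 𝔠.HasCorrespondingBoundaryPoints)
    (hD : ∀ (y : 𝔠.opens) (γ : ℝ → 𝒟₂.carrier) (s : Set ℝ),
      𝒟₂.metric.IsEndlessTimelikeCurve 𝒟₂.timeOrientation γ s → (∃ t ∈ s, γ t = 𝔠.map y) →
      ∃ t ∈ s, γ t ∈ range ι₂)
    (hac : ∀ p ∈ range ι₂, ∀ q ∈ range ι₂,
      q ∉ 𝒟₂.metric.chronologicalFuture 𝒟₂.timeOrientation {p}) : VacuumCauchyDevelopment D₂ where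
  toCauchyDevelopment := 𝔠.gluedCauchyDevelopment h hD hac
  isRicciFlat := by
    intro inst
    haveI : 𝔠.gluedMetric.toPseudoRiemannianMetric.HasLeviCivita := inst
    exact 𝔠.isRicciFlat_gluedMetric 𝒟₁.isVacuum 𝒟₂.isVacuum

/-- **The gluing input of the localisation principle** (Hawking–Ellis 1973, §7.6, p. 250;
Choquet-Bruhat–Geroch 1969, p. 334; relative form of Sbierski 2016, §3.3): let `𝒟₁` be a vacuum
Cauchy development of data `D₁` on `N`, `𝒟₂` one of data `D₂` on `X`, and `𝔠 = (U, ψ)` a relative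
common development over `ι₂ : N → M₂` WITHOUT corresponding boundary points, realised over a
region `ψ(U) ⊆ D̃(ι₂ N)` (hD) with `ι₂(N)` achronal in `M₂` (hac). Then there are a vacuum
Cauchy development `Z` of `D₂` (the gluing `M₂ ∪_ψ M₁`), an embedding of developments
`jZ : 𝒟₂ → Z` and a smooth isometric time-orientation preserving open embedding `j' : M₁ → Z`
over `ι₂` (`j' ∘ ι₁ = jZ ∘ ι₂`) with `j' = jZ ∘ ψ` on `U`. [cite: HawkingEllis1973CUP, §7.6, p. 250] -/
theorem exists_hypersurface_extension_of_not_hasCorrespondingBoundaryPoints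
    (𝒟₁ : VacuumCauchyDevelopment D₁) (𝒟₂ : VacuumCauchyDevelopment D₂) {ι₂ : N → 𝒟₂.carrier}
    (𝔠 : CauchyDevelopment.HypCommonDevelopment 𝒟₁.toCauchyDevelopment 𝒟₂.toCauchyDevelopment ι₂)
    (h : ¬ 𝔠.HasCorrespondingBoundaryPoints)
    (hD : ∀ (y : 𝔠.opens) (γ : ℝ → 𝒟₂.carrier) (s : Set ℝ),
      𝒟₂.metric.IsEndlessTimelikeCurve 𝒟₂.timeOrientation γ s → (∃ t ∈ s, γ t = 𝔠.map y) →
      ∃ t ∈ s, γ t ∈ range ι₂)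
    (hac : ∀ p ∈ range ι₂, ∀ q ∈ range ι₂,
      q ∉ 𝒟₂.metric.chronologicalFuture 𝒟₂.timeOrientation {p}) :
    ∃ (Z : VacuumCauchyDevelopment.{u} D₂) (jZ : 𝒟₂.carrier → Z.carrier)
      (j' : 𝒟₁.carrier → Z.carrier),
      (ContMDiff (𝓡 (n + 1)) (𝓡 (n + 1)) ∞ jZ ∧ IsOpenEmbedding jZ ∧
        𝒟₂.metric.IsIsometricImmersion Z.metric.toPseudoRiemannianMetric jZ ∧
        𝒟₂.timeOrientation.PreservesTimeOrientation jZ Z.timeOrientation ∧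
        jZ ∘ 𝒟₂.embed = Z.embed) ∧
      (ContMDiff (𝓡 (n + 1)) (𝓡 (n + 1)) ∞ j' ∧ IsOpenEmbedding j' ∧
        𝒟₁.metric.IsIsometricImmersion Z.metric.toPseudoRiemannianMetric j' ∧
        𝒟₁.timeOrientation.PreservesTimeOrientation j' Z.timeOrientation ∧
        j' ∘ 𝒟₁.embed = jZ ∘ ι₂) ∧
      ∀ y : 𝔠.opens, j' y = jZ (𝔠.map y) :=
  ⟨hypGluedVacuumCauchyDevelopment 𝒟₁ 𝒟₂ 𝔠 h hD hac, 𝔠.inrZ h hD hac, 𝔠.inlZ h hD hac,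
    𝔠.inrZ_embeds h hD hac, 𝔠.inlZ_relative h hD hac, 𝔠.inlZ_coe_eq_inrZ_map h hD hac⟩

/-- **The gluing in the displayed ("cluster point") form.** Let `𝒟'` be a vacuum Cauchy
development of data `D₁` on `N`, `𝒟` one of data `D₂` on `X`, `ι₂ : N → M` a map with achronal
image, and `(U, ψ)` the seven displayed conjuncts of a common sub-development over `ι₂`
(`ι'(N) ⊆ U` connected, `ι'(N)` Cauchy in `U`, `ψ` smooth, isometric and time-orientation
preserving ON `U`, `ψ ∘ ι' = ι₂`) with `ψ` injective on `U`, `ψ(U) ⊆ D̃(ι₂ N)` and no cluster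
point of `ψ` along `U` at a point of `∂U`. Then the gluing `Z = M ∪_ψ M'` is a vacuum Cauchy
development of `D₂` receiving `𝒟` as developments (`jZ`) and `M'` by a smooth isometric
time-orientation preserving open embedding `j'` with `j' = jZ ∘ ψ` on `U`: the datum
`HypCommonDevelopment` is assembled from the conjuncts, a corresponding pair of Def. 11 is a
cluster point of `ψ` along `U`, and `exists_hypersurface_extension_of_not_hasCorrespondingBoundaryPoints`
applies. [cite: HawkingEllis1973CUP, §7.6, p. 250] -/
theorem exists_hypersurface_extension_of_not_clusterPt (𝒟' : VacuumCauchyDevelopment.{u} D₁)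
    (𝒟 : VacuumCauchyDevelopment.{u} D₂) (ι₂ : N → 𝒟.carrier)
    (hac : ∀ p ∈ range ι₂, ∀ q ∈ range ι₂,
      q ∉ 𝒟.metric.chronologicalFuture 𝒟.timeOrientation {p})
    (U : Opens 𝒟'.carrier) (ψ : 𝒟'.carrier → 𝒟.carrier)
    (hP : (∀ u, 𝒟'.embed u ∈ U) ∧ IsConnected (U : Set 𝒟'.carrier) ∧
      (𝒟'.metric.restrict PseudoRiemannianMetric.contMDiff_restrict_holds U).IsCauchyHypersurface
        (𝒟'.timeOrientation.restrict PseudoRiemannianMetric.contMDiff_restrict_holds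
          𝒟'.timeOrientation.contMDiff_restrict_holds U) (Subtype.val ⁻¹' range 𝒟'.embed) ∧
      ContMDiffOn (𝓡 (n + 1)) (𝓡 (n + 1)) ∞ ψ U ∧
      (∀ p ∈ U, pullbackBilin (I := 𝓡 (n + 1)) (I' := 𝓡 (n + 1)) ψ 𝒟.metric.val p =
        𝒟'.metric.val p) ∧
      (∀ p ∈ U, 𝒟.timeOrientation.IsFutureDirected
        (mfderiv (𝓡 (n + 1)) (𝓡 (n + 1)) ψ p (𝒟'.timeOrientation.vectorField p))) ∧
      ψ ∘ 𝒟'.embed = ι₂)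
    (hinj : InjOn ψ U)
    (hD : ∀ x ∈ U, ∀ (γ : ℝ → 𝒟.carrier) (s : Set ℝ),
      𝒟.metric.IsEndlessTimelikeCurve 𝒟.timeOrientation γ s → (∃ t ∈ s, γ t = ψ x) →
      ∃ t ∈ s, γ t ∈ range ι₂)
    (hncb : ∀ p ∈ frontier (U : Set 𝒟'.carrier), ∀ q : 𝒟.carrier,
      ¬ ClusterPt q (map ψ (𝓝[(U : Set 𝒟'.carrier)] p))) :
    ∃ (Z : VacuumCauchyDevelopment.{u} D₂) (jZ : 𝒟.carrier → Z.carrier)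
        (j' : 𝒟'.carrier → Z.carrier),
      (ContMDiff (𝓡 (n + 1)) (𝓡 (n + 1)) ∞ jZ ∧ IsOpenEmbedding jZ ∧
        𝒟.metric.IsIsometricImmersion Z.metric.toPseudoRiemannianMetric jZ ∧
        𝒟.timeOrientation.PreservesTimeOrientation jZ Z.timeOrientation ∧
        jZ ∘ 𝒟.embed = Z.embed) ∧
      (ContMDiff (𝓡 (n + 1)) (𝓡 (n + 1)) ∞ j' ∧ IsOpenEmbedding j' ∧
        𝒟'.metric.IsIsometricImmersion Z.metric.toPseudoRiemannianMetric j' ∧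
        𝒟'.timeOrientation.PreservesTimeOrientation j' Z.timeOrientation) ∧
      ∀ x ∈ U, j' x = jZ (ψ x) := by
  obtain ⟨hι, hU, hC, hs, hi, ht, hc⟩ := hP
  -- `ψ ∘ Subtype.val` is a smooth t.o.p. isometric immersion of `(U, g'|_U)` into `𝒟`
  have hsmooth : ContMDiff (𝓡 (n + 1)) (𝓡 (n + 1)) ∞ (ψ ∘ (Subtype.val : U → 𝒟'.carrier)) :=
    hs.comp_contMDiff contMDiff_subtype_val fun p ↦ p.2
  have hmf : ∀ (y : U) (v : TangentSpace (𝓡 (n + 1)) y),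
      mfderiv (𝓡 (n + 1)) (𝓡 (n + 1)) (ψ ∘ (Subtype.val : U → 𝒟'.carrier)) y v =
        mfderiv (𝓡 (n + 1)) (𝓡 (n + 1)) ψ y.1 v := by
    intro y v
    have hd : MDifferentiableAt (𝓡 (n + 1)) (𝓡 (n + 1)) ψ y.1 :=
      ((hs y.1 y.2).contMDiffAt (U.2.mem_nhds y.2)).mdifferentiableAt (by simp)
    rw [mfderiv_comp y hd
      (hasMFDerivAt_subtypeVal (I' := 𝓡 (n + 1)) (W := U) y).mdifferentiableAt, mfderiv_subtypeVal]
    rfl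
  have hiso : (𝒟'.metric.restrict PseudoRiemannianMetric.contMDiff_restrict_holds U).IsIsometricImmersion
      𝒟.metric.toPseudoRiemannianMetric (ψ ∘ (Subtype.val : U → 𝒟'.carrier)) := by
    refine ⟨hsmooth, fun (y : U) ↦ ?_⟩
    ext v w
    have hk := congrArg (fun b ↦ b v w) (hi y.1 y.2)
    simp only [pullbackBilin_apply] at hk
    change 𝒟.metric.val (ψ y.1)
        (mfderiv (𝓡 (n + 1)) (𝓡 (n + 1)) (ψ ∘ (Subtype.val : U → 𝒟'.carrier)) y v)
        (mfderiv (𝓡 (n + 1)) (𝓡 (n + 1)) (ψ ∘ (Subtype.val : U → 𝒟'.carrier)) y w) =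
      𝒟'.metric.val y.1 v w
    rw [hmf y v, hmf y w]
    exact hk
  have hτ : (𝒟'.timeOrientation.restrict PseudoRiemannianMetric.contMDiff_restrict_holds
      𝒟'.timeOrientation.contMDiff_restrict_holds U).PreservesTimeOrientation
      (ψ ∘ (Subtype.val : U → 𝒟'.carrier)) 𝒟.timeOrientation := fun (y : U) ↦ by
    change 𝒟.timeOrientation.IsFutureDirected
      (mfderiv (𝓡 (n + 1)) (𝓡 (n + 1)) (ψ ∘ (Subtype.val : U → 𝒟'.carrier)) y
        (𝒟'.timeOrientation.vectorField y.1))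
    rw [hmf]
    exact ht y.1 y.2
  -- the common development datum over `ι₂`
  let 𝔠 : CauchyDevelopment.HypCommonDevelopment 𝒟'.toCauchyDevelopment 𝒟.toCauchyDevelopment ι₂ :=
    { opens := U
      embed_mem := hι
      isCauchyHypersurface := hC
      map := ψ ∘ (Subtype.val : U → 𝒟'.carrier)
      isIsometricImmersion := hiso
      preservesTimeOrientation := hτ
      map_comp_embedOpens := funext fun u ↦ congrFun hc u
      injective_map := fun y₁ y₂ h ↦ Subtype.ext (hinj y₁.2 y₂.2 h) }
  -- no corresponding boundary points
  have hncb' : ¬ 𝔠.HasCorrespondingBoundaryPoints := by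
    rintro ⟨p, q, hpfr, -, hN⟩
    refine hncb p hpfr q ?_
    rw [clusterPt_iff_nonempty]
    intro V' hV' W hW
    rw [mem_map, mem_nhdsWithin] at hW
    obtain ⟨V, hVo, hpV, hVW⟩ := hW
    obtain ⟨y, hyV, hyV'⟩ := hN V (hVo.mem_nhds hpV) V' hV'
    exact ⟨ψ y, hyV', hVW ⟨hyV, y.2⟩⟩
  obtain ⟨Z, jZ, j', hjZ, ⟨hj's, hj'o, hj'i, hj't, -⟩, hcompat⟩ :=
    exists_hypersurface_extension_of_not_hasCorrespondingBoundaryPoints 𝒟' 𝒟 𝔠 hncb'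
      (fun y γ s hγ hy ↦ hD y.1 y.2 γ s hγ hy) hac
  exact ⟨Z, jZ, j', hjZ, ⟨hj's, hj'o, hj'i, hj't⟩, fun x hx ↦ hcompat ⟨x, hx⟩⟩

end VacuumCauchyDevelopment

end Developments

end Literature.Geometry.Lorentzian

end
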